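import Mathlib
import Literature.Geometry.Symplectic.JHolomorphicMap
import Literature.Geometry.Symplectic.JHolomorphicWeierstrassAprioriEnergy
import HarnessLib

/-!
# Generalized Weierstraß theorem for `J`-holomorphic maps: bootstrapping steps, analytic inputs

Part 2/3 of the Literature proof of `Literature.Geometry.Symplectic.JHolomorphicWeierstrassR4`
(Hummel 1997, Ch. III Prop. 3.1; McDuff–Salamon 2012, Thm B.4.2), continuing
`Literature/Geometry/Symplectic/JHolomorphicWeierstrassAprioriEnergy.lean`: the three
bootstrapping steps `α, β, γ` (`Apriori.alpha/beta/gamma`: an `H¹`-estimate from the equation,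
Ladyzhenskaya's inequality, a sup bound), and the equation-free analytic inputs they consume
(`H1Estimate.*`, `Ladyzhenskaya.*`, `NormIteratedFDerivLe.*`, `SupBound.*`), the Zalcman
rescaling lemma (`Zalcman.*`), smooth limits from uniform derivative bounds (`SmoothLimit.*`),
and derivative bounds on compacts from local a-priori estimates (`helper_derivBoundsLocal_of`).
Maps `ℂ → EuclideanSpace ℝ (Fin d)`, any `d`.

Provenance: Summits-side files `Theorems/SullivanDualTameOrBrodyR4Apriori{Alpha,Beta,Gamma}.lean`,
`…TameOrBrodyR4Stub{H1Estimate,Ladyzhenskaya,NormIteratedFDerivLe,SupBound,Zalcman,SmoothLimit}.lean`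
and `…WitnessChargeHelperDerivBoundsLocal.lean` of summit `SmoothPoincare4`, re-homed verbatim
(namespace `Literature.Geometry.Symplectic.JHolomorphicWeierstrassProof`, `4 ↦ d`; promotion
request event 3680949). Original module headers are kept below as section headers.

## References

* C. Hummel, *Gromov's Compactness Theorem for Pseudo-holomorphic Curves* (1997), Ch. III
  Prop. 3.1. [Hummel1997]
* D. McDuff, D. Salamon, *J-holomorphic curves and symplectic topology*, 2nd ed. (2012),
  Thm B.4.2. [McDuffSalamon2012]
-/

noncomputable section

/-!
## Part `SullivanDualTameOrBrodyR4AprioriAlpha`: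
### A-priori estimate for `J`-holomorphic maps: part 4, step α

Helper file of the lead (c2) for stub `stub_aprioriOf` of line `Sketch`, crux `TameOrBrodyR4`
(stmt-SmoothPoincare4-7826, route SullivanDual). Step α of the bootstrapping (registered sub-goal `alpha`): with the orders `≤ n - 2` frozen on a disc, one more derivative is bounded in `L²` on a smaller disc, `∫_{D_{ρ'}} ‖D^{n+1}g‖² ≤ C (1 + ∫_{D_ρ} ‖D^{n-1}g‖⁴ + ∫_{D_ρ} ‖Dⁿg‖²)`, with `C` independent of `g` (localised energy estimate for every word, commutator source bound, sum over the `2^{n+1}` words).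
-/

open scoped ContDiff Topology Nat
open Filter Set Literature.Geometry.Symplectic

namespace Literature.Geometry.Symplectic.JHolomorphicWeierstrassProof

variable {d : ℕ}
namespace Apriori

/-! ### Step α: one more derivative in `L²` -/

section Alpha

open MeasureTheory Metric

/-- **Step α for one word.** For a `C^∞` map `w : ℂ → ℝ⁴` (a word derivative of `g`) with
`‖w‖ ≤ y`, source `‖∂₂w - A ∂₁w‖ ≤ C_s (1 + x² + y)` on the disc `‖z‖ ≤ ρ` containing the support
of the cut-off `χ`, `‖A‖ ≤ M₀` there, and frozen coefficients as in `energy_localized`: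
`∫ ‖∂₁(χw)‖² + ‖∂₂(χw)‖² ≤ 4(1 + ‖A₀‖²)(6 C_s² (V + ∫_{D_ρ} x⁴ + ∫_{D_ρ} y²) + 2 C_χ² (1+M₀)² ∫_{D_ρ} y²)`. [folklore] -/
theorem alpha_word
    (h1 : ∀ (A₀ : (EuclideanSpace ℝ (Fin d)) →L[ℝ] (EuclideanSpace ℝ (Fin d))), (∀ v, A₀ (A₀ v) = -v) → ∀ (W : ℂ → (EuclideanSpace ℝ (Fin d))), ContDiff ℝ ∞ W →
      HasCompactSupport W → (∫ z, (‖fderiv ℝ W z 1‖ ^ 2 + ‖fderiv ℝ W z Complex.I‖ ^ 2)) ≤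
        (1 + ‖A₀‖ ^ 2) * ∫ z, ‖fderiv ℝ W z Complex.I - A₀ (fderiv ℝ W z 1)‖ ^ 2)
    (A₀ : (EuclideanSpace ℝ (Fin d)) →L[ℝ] (EuclideanSpace ℝ (Fin d))) (hA₀ : ∀ v, A₀ (A₀ v) = -v) (A : ℂ → (EuclideanSpace ℝ (Fin d)) →L[ℝ] (EuclideanSpace ℝ (Fin d))) (hA : Continuous A)
    (w : ℂ → (EuclideanSpace ℝ (Fin d))) (hw : ContDiff ℝ ∞ w) (χ : ℂ → ℝ) (hχ : ContDiff ℝ ∞ χ)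
    (hχc : HasCompactSupport χ) (ε : ℝ) (hε : 4 * (1 + ‖A₀‖ ^ 2) * ε ^ 2 ≤ 1)
    (hAε : ∀ z ∈ tsupport χ, ‖A z - A₀‖ ≤ ε) {ρ Cχ M₀ Cs : ℝ} (hCs : 0 ≤ Cs) (hM₀ : 0 ≤ M₀)
    (hsupp : ∀ z ∈ tsupport χ, ‖z‖ ≤ ρ) (hχ1 : ∀ z, |χ z| ≤ 1)
    (hCχ : ∀ z v, ‖fderiv ℝ χ z v‖ ≤ Cχ * ‖v‖) (hAz : ∀ z : ℂ, ‖z‖ ≤ ρ → ‖A z‖ ≤ M₀)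
    (x y : ℂ → ℝ) (hx : Continuous x) (hyc : Continuous y) (hy0 : ∀ z, 0 ≤ y z)
    (hwy : ∀ z, ‖w z‖ ≤ y z)
    (hs : ∀ z : ℂ, ‖z‖ ≤ ρ → ‖fderiv ℝ w z Complex.I - A z (fderiv ℝ w z 1)‖ ≤
      Cs * (1 + x z ^ 2 + y z)) :
    (∫ z, (‖fderiv ℝ (fun t => χ t • w t) z 1‖ ^ 2 +
        ‖fderiv ℝ (fun t => χ t • w t) z Complex.I‖ ^ 2)) ≤
      4 * (1 + ‖A₀‖ ^ 2) * (6 * Cs ^ 2 * ((volume (closedBall (0 : ℂ) ρ)).toReal +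
        (∫ z in closedBall (0 : ℂ) ρ, x z ^ 4) + ∫ z in closedBall (0 : ℂ) ρ, y z ^ 2) +
        2 * Cχ ^ 2 * (1 + M₀) ^ 2 * ∫ z in closedBall (0 : ℂ) ρ, y z ^ 2) := by
  have hE := energy_localized h1 A₀ hA₀ A hA w hw χ hχ hχc ε hε hAε
  have hCχ0 : 0 ≤ Cχ := by
    have := hCχ 0 1
    rw [norm_one, mul_one] at this
    exact (norm_nonneg _).trans this
  -- the source `P` as an opaque function
  obtain ⟨P, hP⟩ : ∃ P : ℂ → (EuclideanSpace ℝ (Fin d)), P = fun z => χ z • (fderiv ℝ w z Complex.I - A z (fderiv ℝ w z 1)) +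
      fderiv ℝ χ z Complex.I • w z - fderiv ℝ χ z 1 • A z (w z) := ⟨_, rfl⟩
  obtain ⟨F, hF⟩ : ∃ F : ℂ → ℝ, F = fun z => 6 * Cs ^ 2 * (1 + x z ^ 4 + y z ^ 2) +
      2 * Cχ ^ 2 * (1 + M₀) ^ 2 * y z ^ 2 := ⟨_, rfl⟩
  -- pointwise bound on the disc
  have hPF : ∀ z, ‖z‖ ≤ ρ → ‖P z‖ ^ 2 ≤ F z := by
    intro z hz
    have hd1 : ‖fderiv ℝ χ z 1‖ ≤ Cχ := by simpa using hCχ z 1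
    have hdI : ‖fderiv ℝ χ z Complex.I‖ ≤ Cχ := by simpa using hCχ z Complex.I
    have hAw : ‖A z (w z)‖ ≤ M₀ * y z :=
      (ContinuousLinearMap.le_opNorm _ _).trans (mul_le_mul (hAz z hz) (hwy z) (norm_nonneg _) hM₀)
    have hP1 : ‖P z‖ ≤ Cs * (1 + x z ^ 2 + y z) + Cχ * y z + Cχ * (M₀ * y z) := by
      have t1 : ‖χ z • (fderiv ℝ w z Complex.I - A z (fderiv ℝ w z 1))‖ ≤
          Cs * (1 + x z ^ 2 + y z) := by
        rw [norm_smul, Real.norm_eq_abs]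
        have h0 : 0 ≤ Cs * (1 + x z ^ 2 + y z) := by have := hy0 z; positivity
        calc |χ z| * ‖fderiv ℝ w z Complex.I - A z (fderiv ℝ w z 1)‖
            ≤ 1 * (Cs * (1 + x z ^ 2 + y z)) := mul_le_mul (hχ1 z) (hs z hz) (norm_nonneg _) zero_le_one
          _ = _ := one_mul _
      have t2 : ‖fderiv ℝ χ z Complex.I • w z‖ ≤ Cχ * y z := by
        rw [norm_smul]; exact mul_le_mul hdI (hwy z) (norm_nonneg _) hCχ0
      have t3 : ‖fderiv ℝ χ z 1 • A z (w z)‖ ≤ Cχ * (M₀ * y z) := by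
        rw [norm_smul]; exact mul_le_mul hd1 hAw (norm_nonneg _) hCχ0
      rw [hP]
      calc _ ≤ ‖χ z • (fderiv ℝ w z Complex.I - A z (fderiv ℝ w z 1))‖ +
            ‖fderiv ℝ χ z Complex.I • w z‖ + ‖fderiv ℝ χ z 1 • A z (w z)‖ :=
            norm_sub_le_of_le (norm_add_le _ _) le_rfl
        _ ≤ _ := by linarith
    rw [hF]
    exact sq_bound_aux (norm_nonneg _) hCs hCχ0 hM₀ (hy0 z) hP1
  -- `∫ ‖P‖² = ∫_{D_ρ} ‖P‖² ≤ ∫_{D_ρ} F`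
  have hPzero : ∀ z, z ∉ closedBall (0 : ℂ) ρ → ‖P z‖ ^ 2 = 0 := by
    intro z hz
    have hz' : z ∉ tsupport χ := fun h => hz (mem_closedBall_zero_iff.mpr (hsupp z h))
    have h0 : χ z = 0 := image_eq_zero_of_notMem_tsupport hz'
    have h0' : fderiv ℝ χ z = 0 := fderiv_eq_zero_of_notMem_tsupport hz'
    simp [hP, h0, h0']
  have hFc : Continuous F := by
    rw [hF]
    exact (continuous_const.mul ((continuous_const.add (hx.pow 4)).add (hyc.pow 2))).add
      (continuous_const.mul (hyc.pow 2))
  have hPc : Continuous fun z => ‖P z‖ ^ 2 := by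
    have hcw : Continuous w := hw.continuous
    have hcw1 : Continuous fun z => fderiv ℝ w z 1 :=
      (hw.continuous_fderiv (by simp)).clm_apply continuous_const
    have hcwI : Continuous fun z => fderiv ℝ w z Complex.I :=
      (hw.continuous_fderiv (by simp)).clm_apply continuous_const
    have hcχ1 : Continuous fun z => fderiv ℝ χ z 1 :=
      (hχ.continuous_fderiv (by simp)).clm_apply continuous_const
    have hcχI : Continuous fun z => fderiv ℝ χ z Complex.I :=
      (hχ.continuous_fderiv (by simp)).clm_apply continuous_const
    rw [hP]
    refine Continuous.pow (Continuous.norm ?_) 2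
    exact ((hχ.continuous.smul (hcwI.sub (hA.clm_apply hcw1))).add (hcχI.smul hcw)).sub
      (hcχ1.smul (hA.clm_apply hcw))
  have hPint : ∫ z, ‖P z‖ ^ 2 ≤ ∫ z in closedBall (0 : ℂ) ρ, F z := by
    rw [integral_eq_setIntegral_of_forall hPzero]
    refine setIntegral_mono_on (integrableOn_closedBall_of_continuous hPc 0 ρ)
      (integrableOn_closedBall_of_continuous hFc 0 ρ) measurableSet_closedBall fun z hz => ?_
    exact hPF z (mem_closedBall_zero_iff.mp hz)
  have hFint : ∫ z in closedBall (0 : ℂ) ρ, F z =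
      6 * Cs ^ 2 * ((volume (closedBall (0 : ℂ) ρ)).toReal +
        (∫ z in closedBall (0 : ℂ) ρ, x z ^ 4) + ∫ z in closedBall (0 : ℂ) ρ, y z ^ 2) +
        2 * Cχ ^ 2 * (1 + M₀) ^ 2 * ∫ z in closedBall (0 : ℂ) ρ, y z ^ 2 := by
    have i1 : IntegrableOn (fun _ : ℂ => (1 : ℝ)) (closedBall (0 : ℂ) ρ) :=
      integrableOn_closedBall_of_continuous continuous_const 0 ρ
    have i4 : IntegrableOn (fun z => x z ^ 4) (closedBall (0 : ℂ) ρ) :=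
      integrableOn_closedBall_of_continuous (hx.pow 4) 0 ρ
    have i2 : IntegrableOn (fun z => y z ^ 2) (closedBall (0 : ℂ) ρ) :=
      integrableOn_closedBall_of_continuous (hyc.pow 2) 0 ρ
    have hV : ∫ _ in closedBall (0 : ℂ) ρ, (1 : ℝ) = (volume (closedBall (0 : ℂ) ρ)).toReal := by
      rw [setIntegral_const, smul_eq_mul, mul_one]; rfl
    have iA : IntegrableOn (fun z => 6 * Cs ^ 2 * (1 + x z ^ 4 + y z ^ 2)) (closedBall (0 : ℂ) ρ) :=
      integrableOn_closedBall_of_continuous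
        (continuous_const.mul ((continuous_const.add (hx.pow 4)).add (hyc.pow 2))) 0 ρ
    have iB : IntegrableOn (fun z => 2 * Cχ ^ 2 * (1 + M₀) ^ 2 * y z ^ 2) (closedBall (0 : ℂ) ρ) :=
      integrableOn_closedBall_of_continuous (continuous_const.mul (hyc.pow 2)) 0 ρ
    have iC : IntegrableOn (fun z => 1 + x z ^ 4) (closedBall (0 : ℂ) ρ) :=
      integrableOn_closedBall_of_continuous (continuous_const.add (hx.pow 4)) 0 ρ
    rw [hF]
    beta_reduce
    rw [integral_add iA iB, integral_const_mul, integral_const_mul, integral_add iC i2,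
      integral_add i1 i4, hV]
  have hmain : ∫ z, ‖P z‖ ^ 2 ≤ _ := hPint.trans (le_of_eq hFint)
  have hE' : (∫ z, (‖fderiv ℝ (fun t => χ t • w t) z 1‖ ^ 2 +
      ‖fderiv ℝ (fun t => χ t • w t) z Complex.I‖ ^ 2)) ≤ 4 * (1 + ‖A₀‖ ^ 2) * ∫ z, ‖P z‖ ^ 2 := by
    rw [hP]; exact hE
  exact hE'.trans (mul_le_mul_of_nonneg_left hmain (by positivity))

/-- **Step α (one more derivative in `L²`).** With the orders `1 ≤ i ≤ n - 2` frozen on the disc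
of radius `ρ` (`ρ` so small that `J ∘ g` is `ε`-close to `J(g 0)` with `4(1 + M₀²)ε² ≤ 1`):
`∫_{D_{ρ'}} ‖D^{n+1}g‖² ≤ C (1 + ∫_{D_ρ} ‖D^{n-1}g‖⁴ + ∫_{D_ρ} ‖Dⁿg‖²)` with `C` independent of `g`. [folklore] -/
theorem alpha
    (h1 : ∀ (A₀ : (EuclideanSpace ℝ (Fin d)) →L[ℝ] (EuclideanSpace ℝ (Fin d))), (∀ v, A₀ (A₀ v) = -v) → ∀ (W : ℂ → (EuclideanSpace ℝ (Fin d))), ContDiff ℝ ∞ W →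
      HasCompactSupport W → (∫ z, (‖fderiv ℝ W z 1‖ ^ 2 + ‖fderiv ℝ W z Complex.I‖ ^ 2)) ≤
        (1 + ‖A₀‖ ^ 2) * ∫ z, ‖fderiv ℝ W z Complex.I - A₀ (fderiv ℝ W z 1)‖ ^ 2)
    (hB : ∀ (n : ℕ) (T : ContinuousMultilinearMap ℝ (fun _ : Fin n => ℂ) (EuclideanSpace ℝ (Fin d))),
      ‖T‖ ≤ ∑ L : Fin n → Fin 2, ‖T (fun j => ![(1 : ℂ), Complex.I] (L j))‖)
    {J : (EuclideanSpace ℝ (Fin d)) → (EuclideanSpace ℝ (Fin d)) →L[ℝ] (EuclideanSpace ℝ (Fin d))} (hJs : ContDiff ℝ ∞ J) (hJ2 : ∀ x v, J x (J x v) = -v)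
    {R₀ M₀ M₁ : ℝ} (hM₀ : ∀ x : (EuclideanSpace ℝ (Fin d)), ‖x‖ ≤ R₀ → ‖J x‖ ≤ M₀)
    (hM₁ : ∀ x : (EuclideanSpace ℝ (Fin d)), ‖x‖ ≤ R₀ → ‖fderiv ℝ J x‖ ≤ M₁)
    {n : ℕ} (hn : 1 ≤ n) {ρ' ρ : ℝ} (hρ' : 0 < ρ') (hρ'ρ : ρ' < ρ) (hρ1 : ρ ≤ 1)
    (hρδ : 16 * (1 + M₀ ^ 2) * M₁ ^ 2 * ρ ^ 2 ≤ 1) (S : ℝ) :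
    ∃ C : ℝ, ∀ g : ℂ → (EuclideanSpace ℝ (Fin d)), ContDiff ℝ ∞ g → IsJHolomorphicFlat J g →
      (∀ z : ℂ, ‖z‖ ≤ 1 → ‖g z‖ ≤ R₀) → (∀ z : ℂ, ‖z‖ ≤ 1 → ‖fderiv ℝ g z‖ ≤ 2) →
      (∀ i, 1 ≤ i → i + 2 ≤ n → ∀ z : ℂ, ‖z‖ ≤ ρ → ‖iteratedFDeriv ℝ i g z‖ ≤ S) →
      ∫ z in closedBall (0 : ℂ) ρ', ‖iteratedFDeriv ℝ (n + 1) g z‖ ^ 2 ≤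
        C * (1 + (∫ z in closedBall (0 : ℂ) ρ, ‖iteratedFDeriv ℝ (n - 1) g z‖ ^ 4) +
          ∫ z in closedBall (0 : ℂ) ρ, ‖iteratedFDeriv ℝ n g z‖ ^ 2) := by
  -- degenerate case `R₀ < 0`: the hypotheses on `g` are contradictory
  rcases lt_or_ge R₀ 0 with hR | hR
  · refine ⟨0, fun g _ _ hg0 _ _ => ?_⟩
    exact absurd ((norm_nonneg (g 0)).trans (hg0 0 (by simp))) (not_le.mpr hR)
  -- constants independent of `g`
  obtain ⟨M, hM⟩ := exists_bound_iteratedFDeriv hJs R₀ n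
  have hM0 : 0 ≤ M := (norm_nonneg _).trans (hM 0 (Nat.zero_le _) 0 (by simpa using hR))
  have hS' : (2 : ℝ) ≤ max S 2 := le_max_right _ _
  have hS'0 : (0 : ℝ) ≤ max S 2 := zero_le_two.trans hS'
  obtain ⟨Cs, hCs_def⟩ : ∃ Cs : ℝ, Cs = ∑ j ∈ Finset.range n, (n.choose (j + 1) : ℝ) * (j + 1)! * M *
      ((max S 2) ^ (j + 1) + 1 + (max S 2) ^ 2 + max S 2) * (2 * max S 2) := ⟨_, rfl⟩
  have hCs : 0 ≤ Cs := by rw [hCs_def]; exact srcConst_nonneg n hM0 hS'0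
  let χ : ContDiffBump (0 : ℂ) := ⟨(2 * ρ' + ρ) / 3, (ρ' + 2 * ρ) / 3, by linarith, by linarith⟩
  have hχIn : ρ' < χ.rIn := by show ρ' < (2 * ρ' + ρ) / 3; linarith
  have hχOut : χ.rOut < ρ := by show (ρ' + 2 * ρ) / 3 < ρ; linarith
  have hχc : ContDiff ℝ ∞ (χ : ℂ → ℝ) := χ.contDiff
  have hχs : HasCompactSupport (χ : ℂ → ℝ) := χ.hasCompactSupport
  obtain ⟨Cχ, hCχ⟩ : ∃ C, ∀ z, ‖fderiv ℝ (χ : ℂ → ℝ) z‖ ≤ C :=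
    (hχs.fderiv (𝕜 := ℝ)).exists_bound_of_continuous (hχc.continuous_fderiv (by simp))
  have hCχ0 : 0 ≤ Cχ := (norm_nonneg _).trans (hCχ 0)
  have hCχv : ∀ z v, ‖fderiv ℝ (χ : ℂ → ℝ) z v‖ ≤ Cχ * ‖v‖ := fun z v =>
    (ContinuousLinearMap.le_opNorm _ _).trans (mul_le_mul_of_nonneg_right (hCχ z) (norm_nonneg _))
  have hχ1 : ∀ z, |(χ : ℂ → ℝ) z| ≤ 1 := fun z => by
    rw [abs_of_nonneg χ.nonneg]; exact χ.le_one
  have hsuppχ : ∀ z ∈ tsupport (χ : ℂ → ℝ), ‖z‖ ≤ ρ := by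
    intro z hz
    rw [χ.tsupport_eq] at hz
    exact (mem_closedBall_zero_iff.mp hz).trans hχOut.le
  obtain ⟨V, hV⟩ : ∃ V : ℝ, V = (volume (closedBall (0 : ℂ) ρ)).toReal := ⟨_, rfl⟩
  have hV0 : 0 ≤ V := by rw [hV]; exact ENNReal.toReal_nonneg
  have hM₀0 : 0 ≤ M₀ := (norm_nonneg _).trans (hM₀ 0 (by simpa using hR))
  obtain ⟨K, hK⟩ : ∃ K : ℝ, K = 4 * (1 + M₀ ^ 2) * (6 * Cs ^ 2 * (V + 1) +
      2 * Cχ ^ 2 * (1 + M₀) ^ 2) := ⟨_, rfl⟩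
  have hK0 : 0 ≤ K := by rw [hK]; positivity
  refine ⟨(2 : ℝ) ^ (n + 1) * 2 ^ (n + 1) * K, fun g hg hgJ hg0 hg1 hlow => ?_⟩
  -- abbreviations for the fixed map `g`
  have hac : ∀ k, Continuous fun z => ‖iteratedFDeriv ℝ k g z‖ := fun k =>
    (hg.continuous_iteratedFDeriv (m := k) (by exact_mod_cast le_top)).norm
  have hA : Continuous fun z => J (g z) := hJs.continuous.comp hg.continuous
  have hA₀2 : ∀ v, J (g 0) (J (g 0) v) = -v := hJ2 (g 0)
  have hA₀n : ‖J (g 0)‖ ≤ M₀ := hM₀ _ (hg0 0 (by simp))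
  have hAz : ∀ z : ℂ, ‖z‖ ≤ ρ → ‖J (g z)‖ ≤ M₀ := fun z hz => hM₀ _ (hg0 z (hz.trans hρ1))
  -- freezing: `‖J(g z) - J(g 0)‖ ≤ ε := 2 M₁ ρ` on the support of `χ`
  have hM₁0 : 0 ≤ M₁ := (norm_nonneg (fderiv ℝ J (g 0))).trans (hM₁ _ (hg0 0 (by simp)))
  have hρ0 : 0 ≤ ρ := by linarith
  have hε : 4 * (1 + ‖J (g 0)‖ ^ 2) * (2 * M₁ * ρ) ^ 2 ≤ 1 := by
    have h' : ‖J (g 0)‖ ^ 2 ≤ M₀ ^ 2 := pow_le_pow_left₀ (norm_nonneg _) hA₀n 2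
    have : 4 * (1 + ‖J (g 0)‖ ^ 2) * (2 * M₁ * ρ) ^ 2 ≤ 4 * (1 + M₀ ^ 2) * (2 * M₁ * ρ) ^ 2 := by
      apply mul_le_mul_of_nonneg_right _ (sq_nonneg _); linarith
    nlinarith
  have hAε : ∀ z ∈ tsupport (χ : ℂ → ℝ), ‖J (g z) - J (g 0)‖ ≤ 2 * M₁ * ρ := by
    intro z hz
    have hzρ := hsuppχ z hz
    have hz1 : ‖z‖ ≤ 1 := hzρ.trans hρ1
    have hgz : ‖g z - g 0‖ ≤ 2 * ‖z - 0‖ :=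
      (convex_closedBall (0 : ℂ) 1).norm_image_sub_le_of_norm_fderiv_le
        (fun x _ => (hg.differentiable (by simp)) x)
        (fun x hx => hg1 x (mem_closedBall_zero_iff.mp hx))
        (by simp) (mem_closedBall_zero_iff.mpr hz1)
    have hJz : ‖J (g z) - J (g 0)‖ ≤ M₁ * ‖g z - g 0‖ :=
      (convex_closedBall (0 : (EuclideanSpace ℝ (Fin d))) R₀).norm_image_sub_le_of_norm_fderiv_le
        (fun x _ => (hJs.differentiable (by simp)) x)
        (fun x hx => hM₁ x (mem_closedBall_zero_iff.mp hx))
        (mem_closedBall_zero_iff.mpr (hg0 0 (by simp))) (mem_closedBall_zero_iff.mpr (hg0 z hz1))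
    rw [sub_zero] at hgz
    calc ‖J (g z) - J (g 0)‖ ≤ M₁ * (2 * ‖z‖) := hJz.trans (mul_le_mul_of_nonneg_left hgz hM₁0)
      _ ≤ M₁ * (2 * ρ) := by gcongr
      _ = 2 * M₁ * ρ := by ring
  -- integrals on the big disc
  obtain ⟨I4, hI4⟩ : ∃ I4 : ℝ, I4 = ∫ z in closedBall (0 : ℂ) ρ, ‖iteratedFDeriv ℝ (n - 1) g z‖ ^ 4 :=
    ⟨_, rfl⟩
  obtain ⟨I2, hI2⟩ : ∃ I2 : ℝ, I2 = ∫ z in closedBall (0 : ℂ) ρ, ‖iteratedFDeriv ℝ n g z‖ ^ 2 :=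
    ⟨_, rfl⟩
  have hI40 : 0 ≤ I4 := by rw [hI4]; exact integral_nonneg fun z => by positivity
  have hI20 : 0 ≤ I2 := by rw [hI2]; exact integral_nonneg fun z => by positivity
  rw [← hI4, ← hI2]
  -- the localized energy bound for every word of length `n`
  have key : ∀ L : Fin n → Fin 2,
      (∫ z, (‖fderiv ℝ (fun t => χ t • iteratedFDeriv ℝ n g t (fun j => ![(1 : ℂ), Complex.I] (L j))) z 1‖ ^ 2 +
        ‖fderiv ℝ (fun t => χ t • iteratedFDeriv ℝ n g t (fun j => ![(1 : ℂ), Complex.I] (L j))) z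
          Complex.I‖ ^ 2)) ≤ K * (1 + I4 + I2) := by
    intro L
    have hw : ContDiff ℝ ∞ (iteratedFDeriv ℝ n g · (fun j => ![(1 : ℂ), Complex.I] (L j))) :=
      contDiff_iteratedFDeriv_apply hg n _
    have hs : ∀ z : ℂ, ‖z‖ ≤ ρ →
        ‖fderiv ℝ (iteratedFDeriv ℝ n g · (fun j => ![(1 : ℂ), Complex.I] (L j))) z Complex.I -
          J (g z) (fderiv ℝ (iteratedFDeriv ℝ n g · (fun j => ![(1 : ℂ), Complex.I] (L j))) z 1)‖ ≤
        Cs * (1 + ‖iteratedFDeriv ℝ (n - 1) g z‖ ^ 2 + ‖iteratedFDeriv ℝ n g z‖) := by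
      intro z hz
      have hz1 : ‖z‖ ≤ 1 := hz.trans hρ1
      rw [hCs_def]
      exact source_pointwise hJs hg hgJ hn hS' L z (fun i hi => hM i hi _ (hg0 z hz1)) (hg1 z hz1)
        (fun i hi1 hi2 => (hlow i hi1 hi2 z hz).trans (le_max_left _ _))
    have hword := alpha_word h1 (J (g 0)) hA₀2 (fun z => J (g z)) hA _ hw χ hχc hχs (2 * M₁ * ρ) hε hAε
      hCs hM₀0 hsuppχ hχ1 hCχv hAz (fun z => ‖iteratedFDeriv ℝ (n - 1) g z‖)
      (fun z => ‖iteratedFDeriv ℝ n g z‖) (hac _) (hac _) (fun z => norm_nonneg _)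
      (fun z => norm_iteratedFDeriv_apply_basis_le g n L z) hs
    rw [← hV, ← hI4, ← hI2] at hword
    rw [hK]
    exact hword.trans (alpha_const_compare (norm_nonneg _) hA₀n hV0 hI40 hI20)
  -- the left-hand side: `a_{n+1}² ≤ 2^{n+1} ∑_{L'} (‖∂₁(χ w_{tail L'})‖² + ‖∂₂(χ w_{tail L'})‖²)` on the small disc
  have hLHS : ∀ z ∈ closedBall (0 : ℂ) ρ', ‖iteratedFDeriv ℝ (n + 1) g z‖ ^ 2 ≤ (2 : ℝ) ^ (n + 1) *
      ∑ L' : Fin (n + 1) → Fin 2,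
        (‖fderiv ℝ (fun t => χ t • iteratedFDeriv ℝ n g t (fun j => ![(1 : ℂ), Complex.I] (Fin.tail L' j))) z 1‖ ^ 2 +
         ‖fderiv ℝ (fun t => χ t • iteratedFDeriv ℝ n g t (fun j => ![(1 : ℂ), Complex.I] (Fin.tail L' j))) z
           Complex.I‖ ^ 2) := by
    intro z hz
    have hzIn : z ∈ ball (0 : ℂ) χ.rIn :=
      mem_ball_zero_iff.mpr ((mem_closedBall_zero_iff.mp hz).trans_lt hχIn)
    refine (sq_norm_le_of_basis hB (n + 1) (iteratedFDeriv ℝ (n + 1) g z)).trans ?_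
    refine mul_le_mul_of_nonneg_left (Finset.sum_le_sum fun L' _ => ?_) (pow_nonneg zero_le_two _)
    have hsucc := iteratedFDeriv_succ_apply_eq_fderiv hg n (fun j => ![(1 : ℂ), Complex.I] (L' j)) z
    have htail : (Fin.tail fun j => (![(1 : ℂ), Complex.I] : Fin 2 → ℂ) (L' j)) =
        fun j => ![(1 : ℂ), Complex.I] (Fin.tail L' j) := rfl
    rw [htail] at hsucc
    rw [hsucc, ← fderiv_smul_eq_of_mem
      (w := (iteratedFDeriv ℝ n g · (fun j => ![(1 : ℂ), Complex.I] (Fin.tail L' j)))) hzIn]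
    rcases Fin.eq_zero_or_eq_succ (L' 0) with h0 | ⟨j, hj⟩
    · simp only [h0, Matrix.cons_val_zero]
      exact le_add_of_nonneg_right (sq_nonneg _)
    · simp only [hj, Fin.eq_zero j, Matrix.cons_val_succ, Matrix.cons_val_zero]
      exact le_add_of_nonneg_left (sq_nonneg _)
  -- integrability of the localized energy densities
  have hG_int : ∀ L' : Fin (n + 1) → Fin 2, Integrable (fun z =>
      ‖fderiv ℝ (fun t => χ t • iteratedFDeriv ℝ n g t (fun j => ![(1 : ℂ), Complex.I] (Fin.tail L' j))) z 1‖ ^ 2 +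
      ‖fderiv ℝ (fun t => χ t • iteratedFDeriv ℝ n g t (fun j => ![(1 : ℂ), Complex.I] (Fin.tail L' j))) z
        Complex.I‖ ^ 2) := by
    intro L'
    have hW : ContDiff ℝ ∞ (fun t => χ t • iteratedFDeriv ℝ n g t (fun j => ![(1 : ℂ), Complex.I] (Fin.tail L' j))) :=
      hχc.smul (contDiff_iteratedFDeriv_apply hg n _)
    have hWc : HasCompactSupport
        (fun t => χ t • iteratedFDeriv ℝ n g t (fun j => ![(1 : ℂ), Complex.I] (Fin.tail L' j))) :=
      hχs.smul_right
    have hc1 := (hW.continuous_fderiv (by simp)).clm_apply (continuous_const (y := (1 : ℂ)))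
    have hcI := (hW.continuous_fderiv (by simp)).clm_apply (continuous_const (y := Complex.I))
    refine ((hc1.norm.pow 2).add (hcI.norm.pow 2)).integrable_of_hasCompactSupport ?_
    exact hasCompactSupport_of_eq_zero hWc fun z hz => by
      simp [fderiv_eq_zero_of_notMem_tsupport hz]
  have hcard : ((Finset.univ : Finset (Fin (n + 1) → Fin 2)).card : ℝ) = 2 ^ (n + 1) := by simp
  calc ∫ z in closedBall (0 : ℂ) ρ', ‖iteratedFDeriv ℝ (n + 1) g z‖ ^ 2
      ≤ ∫ z in closedBall (0 : ℂ) ρ', (2 : ℝ) ^ (n + 1) * ∑ L' : Fin (n + 1) → Fin 2,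
          (‖fderiv ℝ (fun t => χ t • iteratedFDeriv ℝ n g t (fun j => ![(1 : ℂ), Complex.I] (Fin.tail L' j))) z 1‖ ^ 2 +
           ‖fderiv ℝ (fun t => χ t • iteratedFDeriv ℝ n g t (fun j => ![(1 : ℂ), Complex.I] (Fin.tail L' j))) z
             Complex.I‖ ^ 2) := by
        refine setIntegral_mono_on (integrableOn_closedBall_of_continuous ((hac _).pow 2) 0 ρ') ?_
          measurableSet_closedBall hLHS
        exact ((integrable_finsetSum _ fun L' _ => hG_int L').const_mul _).integrableOn
    _ = (2 : ℝ) ^ (n + 1) * ∑ L' : Fin (n + 1) → Fin 2, ∫ z in closedBall (0 : ℂ) ρ',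
          (‖fderiv ℝ (fun t => χ t • iteratedFDeriv ℝ n g t (fun j => ![(1 : ℂ), Complex.I] (Fin.tail L' j))) z 1‖ ^ 2 +
           ‖fderiv ℝ (fun t => χ t • iteratedFDeriv ℝ n g t (fun j => ![(1 : ℂ), Complex.I] (Fin.tail L' j))) z
             Complex.I‖ ^ 2) := by
        rw [integral_const_mul, integral_finsetSum _ fun L' _ => (hG_int L').integrableOn]
    _ ≤ (2 : ℝ) ^ (n + 1) * ∑ L' : Fin (n + 1) → Fin 2, K * (1 + I4 + I2) := by
        refine mul_le_mul_of_nonneg_left (Finset.sum_le_sum fun L' _ => ?_) (pow_nonneg zero_le_two _)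
        exact (setIntegral_le_integral (hG_int L') (Filter.Eventually.of_forall fun z =>
          add_nonneg (sq_nonneg _) (sq_nonneg _))).trans (key (Fin.tail L'))
    _ = (2 : ℝ) ^ (n + 1) * 2 ^ (n + 1) * K * (1 + I4 + I2) := by
        rw [Finset.sum_const, Finset.card_univ, ← Finset.card_univ, nsmul_eq_mul, hcard]; ring

end Alpha

end Apriori

end Literature.Geometry.Symplectic.JHolomorphicWeierstrassProof

/-!
## Part `SullivanDualTameOrBrodyR4AprioriBeta`:
### A-priori estimate for `J`-holomorphic maps: part 5, step β

Helper file of the lead (c2) for stub `stub_aprioriOf` of line `Sketch`, crux `TameOrBrodyR4`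
(stmt-SmoothPoincare4-7826, route SullivanDual). Step β of the bootstrapping (registered sub-goal `beta`): `∫_{D_{ρ'}} ‖Dⁿg‖⁴ ≤ C (∫_{D_ρ} ‖Dⁿg‖²)(∫_{D_ρ} ‖D^{n+1}g‖² + ∫_{D_ρ} ‖Dⁿg‖²)` from Ladyzhenskaya's inequality (stub `stub_ladyzhenskaya`) applied to the localised words.
-/

open scoped ContDiff Topology Nat
open Filter Set Literature.Geometry.Symplectic

namespace Literature.Geometry.Symplectic.JHolomorphicWeierstrassProof

variable {d : ℕ}
namespace Apriori

/-! ### Step β: an `L⁴` bound from `L²` bounds (Ladyzhenskaya) -/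

section Beta

open MeasureTheory Metric

/-- **Step β for one word.** For `C^∞` maps `w` with `‖w‖ ≤ y`, `‖∂ᵢw‖ ≤ x` and a cut-off `χ`
(`|χ| ≤ 1`, `‖dχ‖ ≤ C_χ`, support in the disc of radius `ρ`), Ladyzhenskaya's inequality for
`χ w` gives `∫ ‖χ w‖⁴ ≤ C_L (∫_{D_ρ} y²) (4 ∫_{D_ρ} x² + 4 C_χ² ∫_{D_ρ} y²)`. [folklore] -/
theorem beta_word {CL : ℝ}
    (hL : ∀ (W : ℂ → (EuclideanSpace ℝ (Fin d))), ContDiff ℝ ∞ W → HasCompactSupport W →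
      (∫ z, ‖W z‖ ^ 4) ≤ CL * ((∫ z, ‖W z‖ ^ 2) *
        ∫ z, (‖fderiv ℝ W z 1‖ ^ 2 + ‖fderiv ℝ W z Complex.I‖ ^ 2)))
    (hCL : 0 ≤ CL) (w : ℂ → (EuclideanSpace ℝ (Fin d))) (hw : ContDiff ℝ ∞ w) (χ : ℂ → ℝ) (hχ : ContDiff ℝ ∞ χ)
    (hχc : HasCompactSupport χ) {ρ Cχ : ℝ} (hsupp : ∀ z ∈ tsupport χ, ‖z‖ ≤ ρ)
    (hχ1 : ∀ z, |χ z| ≤ 1) (hCχ : ∀ z v, ‖fderiv ℝ χ z v‖ ≤ Cχ * ‖v‖)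
    (x y : ℂ → ℝ) (hx : Continuous x) (hyc : Continuous y) (hy0 : ∀ z, 0 ≤ y z)
    (hwy : ∀ z, ‖w z‖ ≤ y z)
    (hwx : ∀ z, ‖fderiv ℝ w z 1‖ ≤ x z ∧ ‖fderiv ℝ w z Complex.I‖ ≤ x z) :
    (∫ z, ‖χ z • w z‖ ^ 4) ≤ CL * ((∫ z in closedBall (0 : ℂ) ρ, y z ^ 2) *
      (4 * (∫ z in closedBall (0 : ℂ) ρ, x z ^ 2) + 4 * Cχ ^ 2 * ∫ z in closedBall (0 : ℂ) ρ, y z ^ 2)) := by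
  have hW : ContDiff ℝ ∞ (fun t => χ t • w t) := hχ.smul hw
  have hWc : HasCompactSupport (fun t => χ t • w t) := hχc.smul_right
  have hCχ0 : 0 ≤ Cχ := by
    have := hCχ 0 1
    rw [norm_one, mul_one] at this
    exact (norm_nonneg _).trans this
  refine (hL _ hW hWc).trans (mul_le_mul_of_nonneg_left ?_ hCL)
  have hx0 : ∀ z, 0 ≤ x z := fun z => (norm_nonneg _).trans (hwx z).1
  -- `∫ ‖χ w‖² ≤ ∫_{D_ρ} y²`
  have hzero0 : ∀ z, z ∉ closedBall (0 : ℂ) ρ → ‖χ z • w z‖ ^ 2 = 0 := by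
    intro z hz
    have hz' : z ∉ tsupport χ := fun h => hz (mem_closedBall_zero_iff.mpr (hsupp z h))
    simp [image_eq_zero_of_notMem_tsupport hz']
  have h2 : (∫ z, ‖χ z • w z‖ ^ 2) ≤ ∫ z in closedBall (0 : ℂ) ρ, y z ^ 2 := by
    rw [integral_eq_setIntegral_of_forall hzero0]
    refine setIntegral_mono_on (integrableOn_closedBall_of_continuous
        ((hχ.continuous.smul hw.continuous).norm.pow 2) 0 ρ)
      (integrableOn_closedBall_of_continuous (hyc.pow 2) 0 ρ) measurableSet_closedBall fun z _ => ?_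
    have : ‖χ z • w z‖ ≤ y z := by
      rw [norm_smul, Real.norm_eq_abs]
      calc |χ z| * ‖w z‖ ≤ 1 * y z := mul_le_mul (hχ1 z) (hwy z) (norm_nonneg _) zero_le_one
        _ = y z := one_mul _
    exact pow_le_pow_left₀ (norm_nonneg _) this 2
  -- `∫ ‖∂₁(χw)‖² + ‖∂₂(χw)‖² ≤ 4 ∫_{D_ρ} x² + 4 Cχ² ∫_{D_ρ} y²`
  have hdW : ∀ z v, fderiv ℝ (fun t => χ t • w t) z v = χ z • fderiv ℝ w z v + fderiv ℝ χ z v • w z :=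
    fun z v => fderiv_smul_apply' hχ hw z v
  have hzero1 : ∀ z, z ∉ closedBall (0 : ℂ) ρ →
      ‖fderiv ℝ (fun t => χ t • w t) z 1‖ ^ 2 + ‖fderiv ℝ (fun t => χ t • w t) z Complex.I‖ ^ 2 = 0 := by
    intro z hz
    have hz' : z ∉ tsupport χ := fun h => hz (mem_closedBall_zero_iff.mpr (hsupp z h))
    have hz'' : z ∉ tsupport (fun t => χ t • w t) := fun h => hz' (tsupport_smul_subset_left _ _ h)
    simp [fderiv_eq_zero_of_notMem_tsupport hz'']
  have hpt : ∀ z, ‖fderiv ℝ (fun t => χ t • w t) z 1‖ ^ 2 +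
      ‖fderiv ℝ (fun t => χ t • w t) z Complex.I‖ ^ 2 ≤ 4 * x z ^ 2 + 4 * Cχ ^ 2 * y z ^ 2 := by
    intro z
    have hb : ∀ v : ℂ, ‖v‖ = 1 → ‖fderiv ℝ w z v‖ ≤ x z →
        ‖fderiv ℝ (fun t => χ t • w t) z v‖ ^ 2 ≤ 2 * x z ^ 2 + 2 * Cχ ^ 2 * y z ^ 2 := by
      intro v hv hwv
      rw [hdW]
      have t1 : ‖χ z • fderiv ℝ w z v‖ ≤ x z := by
        rw [norm_smul, Real.norm_eq_abs]
        calc |χ z| * ‖fderiv ℝ w z v‖ ≤ 1 * x z := mul_le_mul (hχ1 z) hwv (norm_nonneg _) zero_le_one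
          _ = x z := one_mul _
      have t2 : ‖fderiv ℝ χ z v • w z‖ ≤ Cχ * y z := by
        rw [norm_smul]
        have := hCχ z v
        rw [hv, mul_one] at this
        exact mul_le_mul this (hwy z) (norm_nonneg _) hCχ0
      have hsum := (norm_add_le _ _).trans (add_le_add t1 t2)
      have h0 : 0 ≤ x z + Cχ * y z := by have := hx0 z; have := hy0 z; positivity
      calc ‖χ z • fderiv ℝ w z v + fderiv ℝ χ z v • w z‖ ^ 2 ≤ (x z + Cχ * y z) ^ 2 :=
            pow_le_pow_left₀ (norm_nonneg _) hsum 2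
        _ ≤ 2 * x z ^ 2 + 2 * Cχ ^ 2 * y z ^ 2 := by nlinarith [sq_nonneg (x z - Cχ * y z)]
    have := hb 1 norm_one (hwx z).1
    have := hb Complex.I Complex.norm_I (hwx z).2
    linarith
  have hcont : Continuous fun z => ‖fderiv ℝ (fun t => χ t • w t) z 1‖ ^ 2 +
      ‖fderiv ℝ (fun t => χ t • w t) z Complex.I‖ ^ 2 :=
    (((hW.continuous_fderiv (by simp)).clm_apply continuous_const).norm.pow 2).add
      (((hW.continuous_fderiv (by simp)).clm_apply continuous_const).norm.pow 2)
  have h3 : (∫ z, (‖fderiv ℝ (fun t => χ t • w t) z 1‖ ^ 2 +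
      ‖fderiv ℝ (fun t => χ t • w t) z Complex.I‖ ^ 2)) ≤
      4 * (∫ z in closedBall (0 : ℂ) ρ, x z ^ 2) + 4 * Cχ ^ 2 * ∫ z in closedBall (0 : ℂ) ρ, y z ^ 2 := by
    rw [integral_eq_setIntegral_of_forall hzero1]
    have iA : IntegrableOn (fun z => 4 * x z ^ 2) (closedBall (0 : ℂ) ρ) :=
      integrableOn_closedBall_of_continuous (continuous_const.mul (hx.pow 2)) 0 ρ
    have iB : IntegrableOn (fun z => 4 * Cχ ^ 2 * y z ^ 2) (closedBall (0 : ℂ) ρ) :=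
      integrableOn_closedBall_of_continuous (continuous_const.mul (hyc.pow 2)) 0 ρ
    calc _ ≤ ∫ z in closedBall (0 : ℂ) ρ, (4 * x z ^ 2 + 4 * Cχ ^ 2 * y z ^ 2) :=
          setIntegral_mono_on (integrableOn_closedBall_of_continuous hcont 0 ρ) (iA.add iB)
            measurableSet_closedBall fun z _ => hpt z
      _ = _ := by rw [integral_add iA iB, integral_const_mul, integral_const_mul]
  have hI0 : 0 ≤ ∫ z, ‖χ z • w z‖ ^ 2 := integral_nonneg fun z => by positivity
  have hy2 : 0 ≤ ∫ z in closedBall (0 : ℂ) ρ, y z ^ 2 := integral_nonneg fun z => by positivity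
  have hJ0 : 0 ≤ ∫ z, (‖fderiv ℝ (fun t => χ t • w t) z 1‖ ^ 2 +
      ‖fderiv ℝ (fun t => χ t • w t) z Complex.I‖ ^ 2) := integral_nonneg fun z => by positivity
  exact mul_le_mul h2 h3 hJ0 hy2

/-- **Step β (`L⁴` from `L²`).**
`∫_{D_{ρ'}} ‖Dⁿg‖⁴ ≤ C (∫_{D_ρ} ‖Dⁿg‖²) (∫_{D_ρ} ‖D^{n+1}g‖² + ∫_{D_ρ} ‖Dⁿg‖²)` with `C` independent of
the `C^∞` map `g`. [folklore] -/
theorem beta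
    (hL : ∃ C : ℝ, ∀ (W : ℂ → (EuclideanSpace ℝ (Fin d))), ContDiff ℝ ∞ W → HasCompactSupport W →
      (∫ z, ‖W z‖ ^ 4) ≤ C * ((∫ z, ‖W z‖ ^ 2) *
        ∫ z, (‖fderiv ℝ W z 1‖ ^ 2 + ‖fderiv ℝ W z Complex.I‖ ^ 2)))
    (hB : ∀ (n : ℕ) (T : ContinuousMultilinearMap ℝ (fun _ : Fin n => ℂ) (EuclideanSpace ℝ (Fin d))),
      ‖T‖ ≤ ∑ L : Fin n → Fin 2, ‖T (fun j => ![(1 : ℂ), Complex.I] (L j))‖)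
    (n : ℕ) {ρ' ρ : ℝ} (hρ' : 0 < ρ') (hρ'ρ : ρ' < ρ) :
    ∃ C : ℝ, ∀ g : ℂ → (EuclideanSpace ℝ (Fin d)), ContDiff ℝ ∞ g →
      ∫ z in closedBall (0 : ℂ) ρ', ‖iteratedFDeriv ℝ n g z‖ ^ 4 ≤
        C * ((∫ z in closedBall (0 : ℂ) ρ, ‖iteratedFDeriv ℝ n g z‖ ^ 2) *
          ((∫ z in closedBall (0 : ℂ) ρ, ‖iteratedFDeriv ℝ (n + 1) g z‖ ^ 2) +
            ∫ z in closedBall (0 : ℂ) ρ, ‖iteratedFDeriv ℝ n g z‖ ^ 2)) := by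
  obtain ⟨CL₀, hCL₀⟩ := hL
  -- a nonnegative Ladyzhenskaya constant
  have hL' : ∀ (W : ℂ → (EuclideanSpace ℝ (Fin d))), ContDiff ℝ ∞ W → HasCompactSupport W →
      (∫ z, ‖W z‖ ^ 4) ≤ max CL₀ 0 * ((∫ z, ‖W z‖ ^ 2) *
        ∫ z, (‖fderiv ℝ W z 1‖ ^ 2 + ‖fderiv ℝ W z Complex.I‖ ^ 2)) := by
    intro W hW hWc
    refine (hCL₀ W hW hWc).trans (mul_le_mul_of_nonneg_right (le_max_left _ _) ?_)
    exact mul_nonneg (integral_nonneg fun z => by positivity) (integral_nonneg fun z => by positivity)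
  have hCL : 0 ≤ max CL₀ 0 := le_max_right _ _
  let χ : ContDiffBump (0 : ℂ) := ⟨(2 * ρ' + ρ) / 3, (ρ' + 2 * ρ) / 3, by linarith, by linarith⟩
  have hχIn : ρ' < χ.rIn := by show ρ' < (2 * ρ' + ρ) / 3; linarith
  have hχOut : χ.rOut < ρ := by show (ρ' + 2 * ρ) / 3 < ρ; linarith
  have hχc : ContDiff ℝ ∞ (χ : ℂ → ℝ) := χ.contDiff
  have hχs : HasCompactSupport (χ : ℂ → ℝ) := χ.hasCompactSupport
  obtain ⟨Cχ, hCχ⟩ : ∃ C, ∀ z, ‖fderiv ℝ (χ : ℂ → ℝ) z‖ ≤ C :=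
    (hχs.fderiv (𝕜 := ℝ)).exists_bound_of_continuous (hχc.continuous_fderiv (by simp))
  have hCχv : ∀ z v, ‖fderiv ℝ (χ : ℂ → ℝ) z v‖ ≤ Cχ * ‖v‖ := fun z v =>
    (ContinuousLinearMap.le_opNorm _ _).trans (mul_le_mul_of_nonneg_right (hCχ z) (norm_nonneg _))
  have hχ1 : ∀ z, |(χ : ℂ → ℝ) z| ≤ 1 := fun z => by
    rw [abs_of_nonneg χ.nonneg]; exact χ.le_one
  have hsuppχ : ∀ z ∈ tsupport (χ : ℂ → ℝ), ‖z‖ ≤ ρ := by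
    intro z hz
    rw [χ.tsupport_eq] at hz
    exact (mem_closedBall_zero_iff.mp hz).trans hχOut.le
  refine ⟨(8 : ℝ) ^ n * 2 ^ n * (max CL₀ 0 * (4 + 4 * Cχ ^ 2)), fun g hg => ?_⟩
  obtain ⟨I2, hI2⟩ : ∃ I2 : ℝ, I2 = ∫ z in closedBall (0 : ℂ) ρ, ‖iteratedFDeriv ℝ n g z‖ ^ 2 :=
    ⟨_, rfl⟩
  obtain ⟨I2', hI2'⟩ : ∃ I2' : ℝ, I2' = ∫ z in closedBall (0 : ℂ) ρ, ‖iteratedFDeriv ℝ (n + 1) g z‖ ^ 2 :=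
    ⟨_, rfl⟩
  have hI20 : 0 ≤ I2 := by rw [hI2]; exact integral_nonneg fun z => by positivity
  have hI2'0 : 0 ≤ I2' := by rw [hI2']; exact integral_nonneg fun z => by positivity
  rw [← hI2, ← hI2']
  have hac : ∀ k, Continuous fun z => ‖iteratedFDeriv ℝ k g z‖ := fun k =>
    (hg.continuous_iteratedFDeriv (m := k) (by exact_mod_cast le_top)).norm
  -- per word
  have key : ∀ L : Fin n → Fin 2,
      (∫ z, ‖χ z • iteratedFDeriv ℝ n g z (fun j => ![(1 : ℂ), Complex.I] (L j))‖ ^ 4) ≤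
        max CL₀ 0 * (I2 * (4 * I2' + 4 * Cχ ^ 2 * I2)) := by
    intro L
    have hw : ContDiff ℝ ∞ (iteratedFDeriv ℝ n g · (fun j => ![(1 : ℂ), Complex.I] (L j))) :=
      contDiff_iteratedFDeriv_apply hg n _
    have h := beta_word hL' hCL _ hw χ hχc hχs hsuppχ hχ1 hCχv
      (fun z => ‖iteratedFDeriv ℝ (n + 1) g z‖) (fun z => ‖iteratedFDeriv ℝ n g z‖) (hac _) (hac _)
      (fun z => norm_nonneg _) (fun z => norm_iteratedFDeriv_apply_basis_le g n L z)
      (fun z => ⟨by simpa using norm_fderiv_word_le hg n L 0 z,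
        by simpa using norm_fderiv_word_le hg n L 1 z⟩)
    rw [← hI2, ← hI2'] at h
    exact h
  -- the left-hand side on the small disc
  have hLHS : ∀ z ∈ closedBall (0 : ℂ) ρ', ‖iteratedFDeriv ℝ n g z‖ ^ 4 ≤ (8 : ℝ) ^ n *
      ∑ L : Fin n → Fin 2, ‖χ z • iteratedFDeriv ℝ n g z (fun j => ![(1 : ℂ), Complex.I] (L j))‖ ^ 4 := by
    intro z hz
    have hχz : (χ : ℂ → ℝ) z = 1 :=
      χ.one_of_mem_closedBall (mem_closedBall_zero_iff.mpr
        ((mem_closedBall_zero_iff.mp hz).trans hχIn.le) |> fun h => by simpa using h)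
    simp only [hχz, one_smul]
    exact pow_four_norm_le_of_basis hB n _
  have hG_int : ∀ L : Fin n → Fin 2, Integrable (fun z =>
      ‖χ z • iteratedFDeriv ℝ n g z (fun j => ![(1 : ℂ), Complex.I] (L j))‖ ^ 4) := by
    intro L
    have hWc : HasCompactSupport (fun t => χ t • iteratedFDeriv ℝ n g t (fun j => ![(1 : ℂ), Complex.I] (L j))) :=
      hχs.smul_right
    exact ((χ.continuous.smul (contDiff_iteratedFDeriv_apply hg n _).continuous).norm.pow 4)
      |>.integrable_of_hasCompactSupport (hasCompactSupport_of_eq_zero hWc fun z hz => by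
        simp [image_eq_zero_of_notMem_tsupport hz])
  have hcard : ((Finset.univ : Finset (Fin n → Fin 2)).card : ℝ) = 2 ^ n := by simp
  calc ∫ z in closedBall (0 : ℂ) ρ', ‖iteratedFDeriv ℝ n g z‖ ^ 4
      ≤ ∫ z in closedBall (0 : ℂ) ρ', (8 : ℝ) ^ n *
          ∑ L : Fin n → Fin 2, ‖χ z • iteratedFDeriv ℝ n g z (fun j => ![(1 : ℂ), Complex.I] (L j))‖ ^ 4 := by
        refine setIntegral_mono_on (integrableOn_closedBall_of_continuous ((hac _).pow 4) 0 ρ') ?_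
          measurableSet_closedBall hLHS
        exact ((integrable_finsetSum _ fun L _ => hG_int L).const_mul _).integrableOn
    _ = (8 : ℝ) ^ n * ∑ L : Fin n → Fin 2, ∫ z in closedBall (0 : ℂ) ρ',
          ‖χ z • iteratedFDeriv ℝ n g z (fun j => ![(1 : ℂ), Complex.I] (L j))‖ ^ 4 := by
        rw [integral_const_mul, integral_finsetSum _ fun L _ => (hG_int L).integrableOn]
    _ ≤ (8 : ℝ) ^ n * ∑ L : Fin n → Fin 2, max CL₀ 0 * (I2 * (4 * I2' + 4 * Cχ ^ 2 * I2)) := by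
        refine mul_le_mul_of_nonneg_left (Finset.sum_le_sum fun L _ => ?_) (pow_nonneg (by norm_num) _)
        exact (setIntegral_le_integral (hG_int L) (Filter.Eventually.of_forall fun z =>
          pow_nonneg (norm_nonneg _) 4)).trans (key L)
    _ = (8 : ℝ) ^ n * 2 ^ n * (max CL₀ 0 * (I2 * (4 * I2' + 4 * Cχ ^ 2 * I2))) := by
        rw [Finset.sum_const, Finset.card_univ, ← Finset.card_univ, nsmul_eq_mul, hcard]; ring
    _ ≤ (8 : ℝ) ^ n * 2 ^ n * (max CL₀ 0 * (4 + 4 * Cχ ^ 2)) * (I2 * (I2' + I2)) := by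
        have h0 : I2 * (4 * I2' + 4 * Cχ ^ 2 * I2) ≤ (4 + 4 * Cχ ^ 2) * (I2 * (I2' + I2)) := by
          nlinarith [mul_nonneg hI20 hI2'0, mul_nonneg hI20 hI20, sq_nonneg Cχ,
            mul_nonneg (mul_nonneg hI20 hI2'0) (sq_nonneg Cχ), mul_nonneg (mul_nonneg hI20 hI20) (sq_nonneg Cχ)]
        have h1 := mul_le_mul_of_nonneg_left h0 hCL
        have h2 := mul_le_mul_of_nonneg_left h1 (by positivity : (0 : ℝ) ≤ 8 ^ n * 2 ^ n)
        nlinarith [h2]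

end Beta

end Apriori

end Literature.Geometry.Symplectic.JHolomorphicWeierstrassProof

/-!
## Part `SullivanDualTameOrBrodyR4AprioriGamma`:
### A-priori estimate for `J`-holomorphic maps: part 6, step γ

Helper file of the lead (c2) for stub `stub_aprioriOf` of line `Sketch`, crux `TameOrBrodyR4`
(stmt-SmoothPoincare4-7826, route SullivanDual). Step γ of the bootstrapping (registered sub-goal `gamma`): a sup bound `‖Dⁿg(z)‖ ≤ C (1 + ∫_{D_ρ} ‖D^{n+2}g‖² + ∫_{D_ρ} ‖D^{n+1}g‖² + ∫_{D_ρ} ‖Dⁿg‖²)` on a smaller disc, from the sup bound of stub `stub_supBound` applied to the localised words.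
-/

open scoped ContDiff Topology Nat
open Filter Set Literature.Geometry.Symplectic

namespace Literature.Geometry.Symplectic.JHolomorphicWeierstrassProof

variable {d : ℕ}
namespace Apriori

/-! ### Step γ: a sup bound from `L²` bounds of two more derivatives -/

section Gamma

open MeasureTheory Metric

/-- Second derivatives of a localised map `χ • w`. [folklore] -/
theorem fderiv_fderiv_smul {G : Type*} [NormedAddCommGroup G] [NormedSpace ℝ G] {χ : ℂ → ℝ}
    {w : ℂ → G} (hχ : ContDiff ℝ ∞ χ) (hw : ContDiff ℝ ∞ w) (z u v : ℂ) :
    fderiv ℝ (fderiv ℝ (fun t => χ t • w t) · u) z v =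
      χ z • fderiv ℝ (fderiv ℝ w · u) z v + fderiv ℝ χ z v • fderiv ℝ w z u +
        (fderiv ℝ χ z u • fderiv ℝ w z v + fderiv ℝ (fderiv ℝ χ · u) z v • w z) := by
  have h1 : (fderiv ℝ (fun t => χ t • w t) · u) =
      (fun t => χ t • fderiv ℝ w t u) + fun t => fderiv ℝ χ t u • w t := by
    funext t
    exact fderiv_smul_apply' hχ hw t u
  have hd1 : ContDiff ℝ ∞ (fun t => χ t • fderiv ℝ w t u) := hχ.smul (contDiff_fderiv_apply hw u)
  have hd2 : ContDiff ℝ ∞ (fun t => fderiv ℝ χ t u • w t) := (contDiff_fderiv_apply hχ u).smul hw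
  rw [h1, fderiv_add ((hd1.differentiable (by simp)) z) ((hd2.differentiable (by simp)) z),
    add_apply]
  have e1 := fderiv_smul_apply' hχ (contDiff_fderiv_apply hw u) z v
  have e2 := fderiv_smul_apply' (χ := (fderiv ℝ χ · u)) (contDiff_fderiv_apply hχ u) hw z v
  rw [e1, e2]

/-- The topological support of a directional derivative of `χ` lies in that of `χ`. [folklore] -/
theorem tsupport_fderiv_apply_subset {χ : ℂ → ℝ} (u : ℂ) :
    tsupport (fderiv ℝ χ · u) ⊆ tsupport χ := by
  refine closure_minimal (fun z hz => ?_) (isClosed_tsupport χ)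
  by_contra h
  exact hz (by simp [fderiv_eq_zero_of_notMem_tsupport h])

/-- **Step γ for one word.** For a `C^∞` map `w` with `‖w‖ ≤ c`, `‖∂ᵥw‖ ≤ b` (`v = 1, i`),
`‖∂₂∂₁w‖ ≤ a`, and a cut-off `χ` with support in the disc of radius `ρ`, the sup bound (stub
`stub_supBound`) gives `‖χ(z₀) w(z₀)‖ ≤ (1 + C_χ + C_χ') (V + ∫_{D_ρ} a² + ∫_{D_ρ} b² + ∫_{D_ρ} c²)`. [folklore] -/
theorem gamma_word
    (hS : ∀ (W : ℂ → (EuclideanSpace ℝ (Fin d))), ContDiff ℝ ∞ W → HasCompactSupport W → ∀ z : ℂ,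
      ‖W z‖ ≤ ∫ y, ‖fderiv ℝ (fun x => fderiv ℝ W x 1) y Complex.I‖)
    (w : ℂ → (EuclideanSpace ℝ (Fin d))) (hw : ContDiff ℝ ∞ w) (χ : ℂ → ℝ) (hχ : ContDiff ℝ ∞ χ)
    (hχc : HasCompactSupport χ) {ρ Cχ Cχ' : ℝ} (hCχ0 : 0 ≤ Cχ) (hCχ'0 : 0 ≤ Cχ')
    (hsupp : ∀ z ∈ tsupport χ, ‖z‖ ≤ ρ)
    (hχ1 : ∀ z, |χ z| ≤ 1) (hCχ : ∀ z v, ‖fderiv ℝ χ z v‖ ≤ Cχ * ‖v‖)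
    (hCχ' : ∀ z, ‖fderiv ℝ (fderiv ℝ χ · 1) z Complex.I‖ ≤ Cχ')
    (a b c : ℂ → ℝ) (ha : Continuous a) (hb : Continuous b) (hc : Continuous c)
    (ha0 : ∀ z, 0 ≤ a z) (hb0 : ∀ z, 0 ≤ b z) (hc0 : ∀ z, 0 ≤ c z)
    (hwc : ∀ z, ‖w z‖ ≤ c z) (hwb : ∀ z, ‖fderiv ℝ w z 1‖ ≤ b z ∧ ‖fderiv ℝ w z Complex.I‖ ≤ b z)
    (hwa : ∀ z, ‖fderiv ℝ (fderiv ℝ w · 1) z Complex.I‖ ≤ a z) (z₀ : ℂ) :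
    ‖χ z₀ • w z₀‖ ≤ (1 + Cχ + Cχ') * ((volume (closedBall (0 : ℂ) ρ)).toReal +
      (∫ z in closedBall (0 : ℂ) ρ, a z ^ 2) + (∫ z in closedBall (0 : ℂ) ρ, b z ^ 2) +
        ∫ z in closedBall (0 : ℂ) ρ, c z ^ 2) := by
  have hW : ContDiff ℝ ∞ (fun t => χ t • w t) := hχ.smul hw
  have hWc : HasCompactSupport (fun t => χ t • w t) := hχc.smul_right
  refine (hS _ hW hWc z₀).trans ?_
  -- the second derivative and its pointwise bound
  have hformula : ∀ z, fderiv ℝ (fun x => fderiv ℝ (fun t => χ t • w t) x 1) z Complex.I =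
      χ z • fderiv ℝ (fderiv ℝ w · 1) z Complex.I + fderiv ℝ χ z Complex.I • fderiv ℝ w z 1 +
        (fderiv ℝ χ z 1 • fderiv ℝ w z Complex.I + fderiv ℝ (fderiv ℝ χ · 1) z Complex.I • w z) :=
    fun z => fderiv_fderiv_smul hχ hw z 1 Complex.I
  have hpt : ∀ z, ‖z‖ ≤ ρ → ‖fderiv ℝ (fun x => fderiv ℝ (fun t => χ t • w t) x 1) z Complex.I‖ ≤
      (1 + Cχ + Cχ') + a z ^ 2 + Cχ * b z ^ 2 + Cχ' * c z ^ 2 := by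
    intro z _
    rw [hformula]
    have t1 : ‖χ z • fderiv ℝ (fderiv ℝ w · 1) z Complex.I‖ ≤ a z := by
      rw [norm_smul, Real.norm_eq_abs]
      calc |χ z| * _ ≤ 1 * a z := mul_le_mul (hχ1 z) (hwa z) (norm_nonneg _) zero_le_one
        _ = a z := one_mul _
    have t2 : ‖fderiv ℝ χ z Complex.I • fderiv ℝ w z 1‖ ≤ Cχ * b z := by
      rw [norm_smul]
      have := hCχ z Complex.I; rw [Complex.norm_I, mul_one] at this
      exact mul_le_mul this (hwb z).1 (norm_nonneg _) hCχ0
    have t3 : ‖fderiv ℝ χ z 1 • fderiv ℝ w z Complex.I‖ ≤ Cχ * b z := by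
      rw [norm_smul]
      have := hCχ z 1; rw [norm_one, mul_one] at this
      exact mul_le_mul this (hwb z).2 (norm_nonneg _) hCχ0
    have t4 : ‖fderiv ℝ (fderiv ℝ χ · 1) z Complex.I • w z‖ ≤ Cχ' * c z := by
      rw [norm_smul]
      exact mul_le_mul (hCχ' z) (hwc z) (norm_nonneg _) hCχ'0
    have hsum : ‖χ z • fderiv ℝ (fderiv ℝ w · 1) z Complex.I + fderiv ℝ χ z Complex.I • fderiv ℝ w z 1 +
        (fderiv ℝ χ z 1 • fderiv ℝ w z Complex.I + fderiv ℝ (fderiv ℝ χ · 1) z Complex.I • w z)‖ ≤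
        a z + Cχ * b z + (Cχ * b z + Cχ' * c z) :=
      (norm_add_le _ _).trans (add_le_add ((norm_add_le _ _).trans (add_le_add t1 t2))
        ((norm_add_le _ _).trans (add_le_add t3 t4)))
    have := ha0 z; have := hb0 z; have := hc0 z
    nlinarith [sq_nonneg (a z - 1), sq_nonneg (b z - 1), sq_nonneg (c z - 1),
      mul_nonneg hCχ0 (sq_nonneg (b z - 1)), mul_nonneg hCχ'0 (sq_nonneg (c z - 1))]
  -- off the disc everything vanishes
  have hzero : ∀ z, z ∉ closedBall (0 : ℂ) ρ →
      ‖fderiv ℝ (fun x => fderiv ℝ (fun t => χ t • w t) x 1) z Complex.I‖ = 0 := by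
    intro z hz
    have hz' : z ∉ tsupport χ := fun h => hz (mem_closedBall_zero_iff.mpr (hsupp z h))
    have h0 : χ z = 0 := image_eq_zero_of_notMem_tsupport hz'
    have h1 : fderiv ℝ χ z = 0 := fderiv_eq_zero_of_notMem_tsupport hz'
    have h2 : fderiv ℝ (fderiv ℝ χ · 1) z = 0 :=
      fderiv_eq_zero_of_notMem_tsupport fun h => hz' (tsupport_fderiv_apply_subset 1 h)
    rw [hformula, h0, h1, h2]
    simp
  have hcont : Continuous fun z => ‖fderiv ℝ (fun x => fderiv ℝ (fun t => χ t • w t) x 1) z Complex.I‖ :=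
    (((contDiff_fderiv_apply hW 1).continuous_fderiv (by simp)).clm_apply continuous_const).norm
  have iK : IntegrableOn (fun z => (1 + Cχ + Cχ') + a z ^ 2 + Cχ * b z ^ 2 + Cχ' * c z ^ 2)
      (closedBall (0 : ℂ) ρ) :=
    integrableOn_closedBall_of_continuous (((continuous_const.add (ha.pow 2)).add
      (continuous_const.mul (hb.pow 2))).add (continuous_const.mul (hc.pow 2))) 0 ρ
  have i1 : IntegrableOn (fun _ : ℂ => (1 + Cχ + Cχ' : ℝ)) (closedBall (0 : ℂ) ρ) :=
    integrableOn_closedBall_of_continuous continuous_const 0 ρ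
  have ia : IntegrableOn (fun z => a z ^ 2) (closedBall (0 : ℂ) ρ) :=
    integrableOn_closedBall_of_continuous (ha.pow 2) 0 ρ
  have ib : IntegrableOn (fun z => Cχ * b z ^ 2) (closedBall (0 : ℂ) ρ) :=
    integrableOn_closedBall_of_continuous (continuous_const.mul (hb.pow 2)) 0 ρ
  have ic : IntegrableOn (fun z => Cχ' * c z ^ 2) (closedBall (0 : ℂ) ρ) :=
    integrableOn_closedBall_of_continuous (continuous_const.mul (hc.pow 2)) 0 ρ
  have hV : ∫ _ in closedBall (0 : ℂ) ρ, (1 + Cχ + Cχ' : ℝ) =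
      (volume (closedBall (0 : ℂ) ρ)).toReal * (1 + Cχ + Cχ') := by
    rw [setIntegral_const, smul_eq_mul]; rfl
  have hIa : 0 ≤ ∫ z in closedBall (0 : ℂ) ρ, a z ^ 2 := integral_nonneg fun z => by positivity
  have hIb : 0 ≤ ∫ z in closedBall (0 : ℂ) ρ, b z ^ 2 := integral_nonneg fun z => by positivity
  have hIc : 0 ≤ ∫ z in closedBall (0 : ℂ) ρ, c z ^ 2 := integral_nonneg fun z => by positivity
  have hV0 : 0 ≤ (volume (closedBall (0 : ℂ) ρ)).toReal := ENNReal.toReal_nonneg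
  calc ∫ z, ‖fderiv ℝ (fun x => fderiv ℝ (fun t => χ t • w t) x 1) z Complex.I‖
      = ∫ z in closedBall (0 : ℂ) ρ, ‖fderiv ℝ (fun x => fderiv ℝ (fun t => χ t • w t) x 1) z Complex.I‖ :=
        integral_eq_setIntegral_of_forall hzero
    _ ≤ ∫ z in closedBall (0 : ℂ) ρ, ((1 + Cχ + Cχ') + a z ^ 2 + Cχ * b z ^ 2 + Cχ' * c z ^ 2) :=
        setIntegral_mono_on (integrableOn_closedBall_of_continuous hcont 0 ρ) iK
          measurableSet_closedBall fun z hz => hpt z (mem_closedBall_zero_iff.mp hz)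
    _ = (volume (closedBall (0 : ℂ) ρ)).toReal * (1 + Cχ + Cχ') + (∫ z in closedBall (0 : ℂ) ρ, a z ^ 2) +
          Cχ * (∫ z in closedBall (0 : ℂ) ρ, b z ^ 2) + Cχ' * ∫ z in closedBall (0 : ℂ) ρ, c z ^ 2 := by
        have iS3 : IntegrableOn (fun z => (1 + Cχ + Cχ') + a z ^ 2 + Cχ * b z ^ 2) (closedBall (0 : ℂ) ρ) :=
          integrableOn_closedBall_of_continuous ((continuous_const.add (ha.pow 2)).add
            (continuous_const.mul (hb.pow 2))) 0 ρ
        have iS2 : IntegrableOn (fun z => (1 + Cχ + Cχ') + a z ^ 2) (closedBall (0 : ℂ) ρ) :=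
          integrableOn_closedBall_of_continuous (continuous_const.add (ha.pow 2)) 0 ρ
        rw [integral_add iS3 ic, integral_add iS2 ib, integral_add i1 ia, hV,
          integral_const_mul, integral_const_mul]
    _ ≤ _ := by
        nlinarith [mul_nonneg hCχ0 hIa, mul_nonneg hCχ'0 hIa, mul_nonneg hCχ0 hIc, mul_nonneg hCχ'0 hIb,
          mul_nonneg hCχ0 hV0, mul_nonneg hCχ'0 hV0, hIb, hIc]

/-- **Step γ (sup bound from `L²` bounds of two more derivatives).** For `z` in the disc of radius
`ρ'`: `‖Dⁿg(z)‖ ≤ C (1 + ∫_{D_ρ} ‖D^{n+2}g‖² + ∫_{D_ρ} ‖D^{n+1}g‖² + ∫_{D_ρ} ‖Dⁿg‖²)` with `C`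
independent of the `C^∞` map `g`. [folklore] -/
theorem gamma
    (hS : ∀ (W : ℂ → (EuclideanSpace ℝ (Fin d))), ContDiff ℝ ∞ W → HasCompactSupport W → ∀ z : ℂ,
      ‖W z‖ ≤ ∫ y, ‖fderiv ℝ (fun x => fderiv ℝ W x 1) y Complex.I‖)
    (hB : ∀ (n : ℕ) (T : ContinuousMultilinearMap ℝ (fun _ : Fin n => ℂ) (EuclideanSpace ℝ (Fin d))),
      ‖T‖ ≤ ∑ L : Fin n → Fin 2, ‖T (fun j => ![(1 : ℂ), Complex.I] (L j))‖)
    (n : ℕ) {ρ' ρ : ℝ} (hρ' : 0 < ρ') (hρ'ρ : ρ' < ρ) :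
    ∃ C : ℝ, ∀ g : ℂ → (EuclideanSpace ℝ (Fin d)), ContDiff ℝ ∞ g → ∀ z ∈ closedBall (0 : ℂ) ρ',
      ‖iteratedFDeriv ℝ n g z‖ ≤
        C * (1 + (∫ z in closedBall (0 : ℂ) ρ, ‖iteratedFDeriv ℝ (n + 2) g z‖ ^ 2) +
          (∫ z in closedBall (0 : ℂ) ρ, ‖iteratedFDeriv ℝ (n + 1) g z‖ ^ 2) +
          ∫ z in closedBall (0 : ℂ) ρ, ‖iteratedFDeriv ℝ n g z‖ ^ 2) := by
  let χ : ContDiffBump (0 : ℂ) := ⟨(2 * ρ' + ρ) / 3, (ρ' + 2 * ρ) / 3, by linarith, by linarith⟩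
  have hχIn : ρ' < χ.rIn := by show ρ' < (2 * ρ' + ρ) / 3; linarith
  have hχOut : χ.rOut < ρ := by show (ρ' + 2 * ρ) / 3 < ρ; linarith
  have hχc : ContDiff ℝ ∞ (χ : ℂ → ℝ) := χ.contDiff
  have hχs : HasCompactSupport (χ : ℂ → ℝ) := χ.hasCompactSupport
  obtain ⟨Cχ, hCχ⟩ : ∃ C, ∀ z, ‖fderiv ℝ (χ : ℂ → ℝ) z‖ ≤ C :=
    (hχs.fderiv (𝕜 := ℝ)).exists_bound_of_continuous (hχc.continuous_fderiv (by simp))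
  have hCχ0 : 0 ≤ Cχ := (norm_nonneg _).trans (hCχ 0)
  have hCχv : ∀ z v, ‖fderiv ℝ (χ : ℂ → ℝ) z v‖ ≤ Cχ * ‖v‖ := fun z v =>
    (ContinuousLinearMap.le_opNorm _ _).trans (mul_le_mul_of_nonneg_right (hCχ z) (norm_nonneg _))
  have hχd : ContDiff ℝ ∞ (fderiv ℝ (χ : ℂ → ℝ) · 1) := contDiff_fderiv_apply hχc 1
  have hχds : HasCompactSupport (fderiv ℝ (χ : ℂ → ℝ) · 1) :=
    hasCompactSupport_of_eq_zero hχs fun z hz => by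
      simp [fderiv_eq_zero_of_notMem_tsupport hz]
  obtain ⟨Cχ', hCχ'⟩ : ∃ C, ∀ z, ‖fderiv ℝ (fderiv ℝ (χ : ℂ → ℝ) · 1) z‖ ≤ C :=
    (hχds.fderiv (𝕜 := ℝ)).exists_bound_of_continuous (hχd.continuous_fderiv (by simp))
  have hCχ'0 : 0 ≤ Cχ' := (norm_nonneg _).trans (hCχ' 0)
  have hCχ'I : ∀ z, ‖fderiv ℝ (fderiv ℝ (χ : ℂ → ℝ) · 1) z Complex.I‖ ≤ Cχ' := fun z =>
    (ContinuousLinearMap.le_opNorm _ _).trans (by rw [Complex.norm_I, mul_one]; exact hCχ' z)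
  have hχ1 : ∀ z, |(χ : ℂ → ℝ) z| ≤ 1 := fun z => by
    rw [abs_of_nonneg χ.nonneg]; exact χ.le_one
  have hsuppχ : ∀ z ∈ tsupport (χ : ℂ → ℝ), ‖z‖ ≤ ρ := by
    intro z hz
    rw [χ.tsupport_eq] at hz
    exact (mem_closedBall_zero_iff.mp hz).trans hχOut.le
  obtain ⟨V, hV⟩ : ∃ V : ℝ, V = (volume (closedBall (0 : ℂ) ρ)).toReal := ⟨_, rfl⟩
  have hV0 : 0 ≤ V := by rw [hV]; exact ENNReal.toReal_nonneg
  refine ⟨(2 : ℝ) ^ n * ((1 + Cχ + Cχ') * (V + 1)), fun g hg z hz => ?_⟩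
  obtain ⟨Ia, hIa⟩ : ∃ I : ℝ, I = ∫ z in closedBall (0 : ℂ) ρ, ‖iteratedFDeriv ℝ (n + 2) g z‖ ^ 2 :=
    ⟨_, rfl⟩
  obtain ⟨Ib, hIb⟩ : ∃ I : ℝ, I = ∫ z in closedBall (0 : ℂ) ρ, ‖iteratedFDeriv ℝ (n + 1) g z‖ ^ 2 :=
    ⟨_, rfl⟩
  obtain ⟨Ic, hIc⟩ : ∃ I : ℝ, I = ∫ z in closedBall (0 : ℂ) ρ, ‖iteratedFDeriv ℝ n g z‖ ^ 2 :=
    ⟨_, rfl⟩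
  have hIa0 : 0 ≤ Ia := by rw [hIa]; exact integral_nonneg fun z => by positivity
  have hIb0 : 0 ≤ Ib := by rw [hIb]; exact integral_nonneg fun z => by positivity
  have hIc0 : 0 ≤ Ic := by rw [hIc]; exact integral_nonneg fun z => by positivity
  rw [← hIa, ← hIb, ← hIc]
  have hac : ∀ k, Continuous fun z => ‖iteratedFDeriv ℝ k g z‖ := fun k =>
    (hg.continuous_iteratedFDeriv (m := k) (by exact_mod_cast le_top)).norm
  have hχz : (χ : ℂ → ℝ) z = 1 :=
    χ.one_of_mem_closedBall (mem_closedBall_zero_iff.mpr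
      ((mem_closedBall_zero_iff.mp hz).trans hχIn.le) |> fun h => by simpa using h)
  -- per word
  have key : ∀ L : Fin n → Fin 2,
      ‖iteratedFDeriv ℝ n g z (fun j => ![(1 : ℂ), Complex.I] (L j))‖ ≤
        (1 + Cχ + Cχ') * (V + Ia + Ib + Ic) := by
    intro L
    have hw : ContDiff ℝ ∞ (iteratedFDeriv ℝ n g · (fun j => ![(1 : ℂ), Complex.I] (L j))) :=
      contDiff_iteratedFDeriv_apply hg n _
    have h := gamma_word hS _ hw χ hχc hχs hCχ0 hCχ'0 hsuppχ hχ1 hCχv hCχ'I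
      (fun z => ‖iteratedFDeriv ℝ (n + 2) g z‖) (fun z => ‖iteratedFDeriv ℝ (n + 1) g z‖)
      (fun z => ‖iteratedFDeriv ℝ n g z‖) (hac _) (hac _) (hac _)
      (fun z => norm_nonneg _) (fun z => norm_nonneg _) (fun z => norm_nonneg _)
      (fun z => norm_iteratedFDeriv_apply_basis_le g n L z)
      (fun z => ⟨by simpa using norm_fderiv_word_le hg n L 0 z,
        by simpa using norm_fderiv_word_le hg n L 1 z⟩)
      (fun z => by simpa using norm_fderiv_fderiv_word_le hg n L 1 0 z) z
    rw [← hV, ← hIa, ← hIb, ← hIc, hχz, one_smul] at h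
    exact h
  have hcard : ((Finset.univ : Finset (Fin n → Fin 2)).card : ℝ) = 2 ^ n := by simp
  calc ‖iteratedFDeriv ℝ n g z‖ ≤ ∑ L : Fin n → Fin 2,
        ‖iteratedFDeriv ℝ n g z (fun j => ![(1 : ℂ), Complex.I] (L j))‖ := hB n _
    _ ≤ ∑ L : Fin n → Fin 2, (1 + Cχ + Cχ') * (V + Ia + Ib + Ic) := Finset.sum_le_sum fun L _ => key L
    _ = (2 : ℝ) ^ n * ((1 + Cχ + Cχ') * (V + Ia + Ib + Ic)) := by
        rw [Finset.sum_const, Finset.card_univ, ← Finset.card_univ, nsmul_eq_mul, hcard]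
    _ ≤ (2 : ℝ) ^ n * ((1 + Cχ + Cχ') * (V + 1)) * (1 + Ia + Ib + Ic) := by
        have h0 : V + Ia + Ib + Ic ≤ (V + 1) * (1 + Ia + Ib + Ic) := by nlinarith
        have h1 : 0 ≤ (1 + Cχ + Cχ') := by positivity
        have h2 := mul_le_mul_of_nonneg_left h0 h1
        have h3 := mul_le_mul_of_nonneg_left h2 (pow_nonneg zero_le_two n)
        nlinarith [h3]

end Gamma

end Apriori

end Literature.Geometry.Symplectic.JHolomorphicWeierstrassProof

/-!
## Part `SullivanDualTameOrBrodyR4StubH1Estimate`: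
### Stub `stub_h1Estimate` of line `Sketch` for crux `TameOrBrodyR4` (stmt-SmoothPoincare4-7826, route SullivanDual)

The constant-coefficient `H¹` ("energy") inequality for the linear Cauchy–Riemann operator
`P W = ∂₂ W - A₀ ∂₁ W` on `ℂ = ℝ²` (`∂₁ = d·(1) = ∂/∂x`, `∂₂ = d·(i) = ∂/∂y`): for a constant
`A₀ : ℝ⁴ →L[ℝ] ℝ⁴` with `A₀² = -1` and a compactly supported `C^∞` map `W : ℂ → ℝ⁴`,

`∫ ‖∂₁W‖² + ‖∂₂W‖² ≤ (1 + ‖A₀‖²) ∫ ‖∂₂W - A₀ ∂₁W‖²`.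

Proof.  Put `m(u, v) := ⟪u, v⟫ + ⟪A₀ u, A₀ v⟫`; then `‖u‖² ≤ m(u, u) ≤ (1 + ‖A₀‖²) ‖u‖²`
(operator norm), `m(A₀ u, A₀ u) = m(u, u)` (because `A₀² = -1`) and
`m(u, A₀ v) = ⟪u, A₀ v⟫ - ⟪A₀ u, v⟫`.  With `a := ∂₂W(z)`, `b := ∂₁W(z)` this gives the pointwise
inequality (`H1Estimate.pointwise`)
`‖b‖² + ‖a‖² ≤ (1 + ‖A₀‖²) ‖a - A₀ b‖² + 2 (⟪a, A₀ b⟫ - ⟪A₀ a, b⟫)`.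
Integrating, it remains to see that `∫ ⟪∂₂W, A₀ ∂₁W⟫ = ∫ ⟪A₀ ∂₂W, ∂₁W⟫` (`H1Estimate.cross_eq`):
integrating by parts (Mathlib's `integral_bilinear_fderiv_right_eq_neg_left_of_integrable` for the
bilinear form `(p, q) ↦ ⟪A₀ p, q⟫`, once in the direction `i` and once in the direction `1`,
`H1Estimate.ibp`) both sides equal `-∫ ⟪A₀ ∂₂∂₁W, W⟫`, by the symmetry of second derivatives
(`ContDiffAt.isSymmSndFDerivAt`).  All integrands are continuous with compact support, hence
integrable.  Uses Mathlib only.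
-/

open scoped ContDiff Topology InnerProductSpace
open Filter Set MeasureTheory

namespace Literature.Geometry.Symplectic.JHolomorphicWeierstrassProof

variable {d : ℕ}
namespace H1Estimate

section Support

variable {G : Type*} [NormedAddCommGroup G]

/-- A continuous combination `m (p z) (q z)` of two compactly supported maps `p q : ℂ → G`, with
`m 0 0 = 0`, is integrable (it is continuous with compact support). [folklore] -/
theorem integrable_comp₂ {p q : ℂ → G} (hpc : HasCompactSupport p) (hqc : HasCompactSupport q)
    (m : G → G → ℝ) (hm : Continuous fun z => m (p z) (q z)) (h0 : m 0 0 = 0) :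
    Integrable (fun z => m (p z) (q z)) :=
  hm.integrable_of_hasCompactSupport (hpc.comp₂_left hqc h0)

end Support

variable {F : Type*} [NormedAddCommGroup F] [InnerProductSpace ℝ F]

/-! ### Pointwise algebra -/

/-- The pointwise inequality behind the `H¹` estimate: for `A₀² = -1` and all `a b`,
`‖b‖² + ‖a‖² ≤ (1 + ‖A₀‖²) ‖a - A₀ b‖² + 2 (⟪a, A₀ b⟫ - ⟪A₀ a, b⟫)`.  Indeed
`‖a - A₀ b‖² + ‖A₀ (a - A₀ b)‖² = ‖a - A₀ b‖² + ‖A₀ a + b‖²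
  = ‖a‖² + ‖b‖² + ‖A₀ a‖² + ‖A₀ b‖² - 2 ⟪a, A₀ b⟫ + 2 ⟪A₀ a, b⟫`
and `‖A₀ (a - A₀ b)‖ ≤ ‖A₀‖ ‖a - A₀ b‖`. [folklore] -/
theorem pointwise (A₀ : F →L[ℝ] F) (hA₀ : ∀ v, A₀ (A₀ v) = -v) (a b : F) :
    ‖b‖ ^ 2 + ‖a‖ ^ 2 ≤
      (1 + ‖A₀‖ ^ 2) * ‖a - A₀ b‖ ^ 2 + 2 * (⟪a, A₀ b⟫_ℝ - ⟪A₀ a, b⟫_ℝ) := by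
  have h1 : ‖a - A₀ b‖ ^ 2 = ‖a‖ ^ 2 - 2 * ⟪a, A₀ b⟫_ℝ + ‖A₀ b‖ ^ 2 := norm_sub_sq_real a (A₀ b)
  have h2 : A₀ (a - A₀ b) = A₀ a + b := by rw [map_sub, hA₀, sub_neg_eq_add]
  have h3 : ‖A₀ (a - A₀ b)‖ ^ 2 = ‖A₀ a‖ ^ 2 + 2 * ⟪A₀ a, b⟫_ℝ + ‖b‖ ^ 2 := by
    rw [h2]; exact norm_add_sq_real (A₀ a) b
  have h4 : ‖A₀ (a - A₀ b)‖ ^ 2 ≤ ‖A₀‖ ^ 2 * ‖a - A₀ b‖ ^ 2 := by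
    rw [← mul_pow]
    exact pow_le_pow_left₀ (norm_nonneg _) (A₀.le_opNorm _) 2
  nlinarith [sq_nonneg ‖A₀ a‖, sq_nonneg ‖A₀ b‖]

/-! ### Calculus on `ℂ = ℝ²` for compactly supported smooth maps -/

section Calculus

variable {W : ℂ → F}

/-- The directional derivatives `z ↦ dW(z) v` of a `C^∞` map are `C^∞`. [folklore] -/
theorem contDiff_fderiv_apply (hW : ContDiff ℝ ∞ W) (v : ℂ) :
    ContDiff ℝ ∞ fun z => fderiv ℝ W z v :=
  (contDiff_infty_iff_fderiv.1 hW).2.clm_apply contDiff_const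

/-- The directional derivatives `z ↦ dW(z) v` of a `C^∞` map are continuous. [folklore] -/
theorem continuous_fderiv_apply (hW : ContDiff ℝ ∞ W) (v : ℂ) :
    Continuous fun z => fderiv ℝ W z v :=
  (contDiff_fderiv_apply hW v).continuous

/-- Iterated directional derivatives are values of the second derivative:
`∂_w (z ↦ dW(z) v) = d²W(z) w v`. [folklore] -/
theorem fderiv_fderiv_apply (hW : ContDiff ℝ ∞ W) (v w z : ℂ) :
    fderiv ℝ (fun x => fderiv ℝ W x v) z w = fderiv ℝ (fderiv ℝ W) z w v := by
  have hd : DifferentiableAt ℝ (fderiv ℝ W) z :=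
    ((contDiff_infty_iff_fderiv.1 hW).2.differentiable (by simp)).differentiableAt
  rw [fderiv_clm_apply hd (differentiableAt_const v)]
  simp

/-- Symmetry of second derivatives of a `C^∞` map: `∂₁ ∂₂ W = ∂₂ ∂₁ W`, written with
directional derivatives `∂_v W = (z ↦ dW(z) v)`. [folklore] -/
theorem fderiv_fderiv_comm (hW : ContDiff ℝ ∞ W) (v w z : ℂ) :
    fderiv ℝ (fun x => fderiv ℝ W x v) z w = fderiv ℝ (fun x => fderiv ℝ W x w) z v := by
  rw [fderiv_fderiv_apply hW, fderiv_fderiv_apply hW]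
  exact (hW.contDiffAt.isSymmSndFDerivAt
    (minSmoothness_of_isRCLikeNormedField.trans_le ENat.LEInfty.out)) w v

/-- **Integration by parts** for the bilinear form `(p, q) ↦ ⟪A₀ p, q⟫` and a compactly supported
`C^∞` map `W : ℂ → F`: `∫ ⟪A₀ ∂_w W, ∂_v W⟫ = -∫ ⟪A₀ ∂_v ∂_w W, W⟫`. [folklore] -/
theorem ibp (A₀ : F →L[ℝ] F) (hW : ContDiff ℝ ∞ W) (hWc : HasCompactSupport W) (v w : ℂ) :
    ∫ z, ⟪A₀ (fderiv ℝ W z w), fderiv ℝ W z v⟫_ℝ =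
      -∫ z, ⟪A₀ (fderiv ℝ (fun x => fderiv ℝ W x w) z v), W z⟫_ℝ := by
  have hWd : Differentiable ℝ W := hW.differentiable (by simp)
  have h1 : ContDiff ℝ ∞ fun x => fderiv ℝ W x w := contDiff_fderiv_apply hW w
  have h1c : HasCompactSupport fun x => fderiv ℝ W x w := hWc.fderiv_apply ℝ w
  have h2c : HasCompactSupport fun x => fderiv ℝ (fun x => fderiv ℝ W x w) x v :=
    h1c.fderiv_apply ℝ v
  have hvc : HasCompactSupport fun x => fderiv ℝ W x v := hWc.fderiv_apply ℝ v
  have hc0 : Continuous W := hW.continuous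
  have hc1 : Continuous fun x => fderiv ℝ W x w := h1.continuous
  have hc2 : Continuous fun x => fderiv ℝ (fun x => fderiv ℝ W x w) x v :=
    continuous_fderiv_apply h1 v
  have hcv : Continuous fun x => fderiv ℝ W x v := continuous_fderiv_apply hW v
  have hf'g : Integrable fun x => ⟪A₀ (fderiv ℝ (fun x => fderiv ℝ W x w) x v), W x⟫_ℝ :=
    integrable_comp₂ h2c hWc (fun p q => ⟪A₀ p, q⟫_ℝ) (by fun_prop) (by simp)
  have hfg' : Integrable fun x => ⟪A₀ (fderiv ℝ W x w), fderiv ℝ W x v⟫_ℝ :=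
    integrable_comp₂ h1c hvc (fun p q => ⟪A₀ p, q⟫_ℝ) (by fun_prop) (by simp)
  have hfg : Integrable fun x => ⟪A₀ (fderiv ℝ W x w), W x⟫_ℝ :=
    integrable_comp₂ h1c hWc (fun p q => ⟪A₀ p, q⟫_ℝ) (by fun_prop) (by simp)
  exact integral_bilinear_fderiv_right_eq_neg_left_of_integrable (μ := (volume : Measure ℂ))
    (B := ((innerSL ℝ).comp A₀ : F →L[ℝ] F →L[ℝ] ℝ)) (f := fun x => fderiv ℝ W x w) (g := W)
    (v := v) hf'g hfg' hfg (fun x _ => (h1.differentiable (by simp)).differentiableAt)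
    (fun x _ => (hWd x))

/-- The cross term of the `H¹` identity: `∫ ⟪∂₂W, A₀ ∂₁W⟫ = ∫ ⟪A₀ ∂₂W, ∂₁W⟫`; after integrating
by parts both sides are `-∫ ⟪A₀ ∂₂∂₁W, W⟫`, by the symmetry of second derivatives. [folklore] -/
theorem cross_eq (A₀ : F →L[ℝ] F) (hW : ContDiff ℝ ∞ W) (hWc : HasCompactSupport W) :
    ∫ z, ⟪fderiv ℝ W z Complex.I, A₀ (fderiv ℝ W z 1)⟫_ℝ =
      ∫ z, ⟪A₀ (fderiv ℝ W z Complex.I), fderiv ℝ W z 1⟫_ℝ := by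
  have hX := ibp A₀ hW hWc Complex.I 1
  have hY := ibp A₀ hW hWc 1 Complex.I
  calc ∫ z, ⟪fderiv ℝ W z Complex.I, A₀ (fderiv ℝ W z 1)⟫_ℝ
      = ∫ z, ⟪A₀ (fderiv ℝ W z 1), fderiv ℝ W z Complex.I⟫_ℝ := by
        congr 1; ext z; exact real_inner_comm _ _
    _ = -∫ z, ⟪A₀ (fderiv ℝ (fun x => fderiv ℝ W x 1) z Complex.I), W z⟫_ℝ := hX
    _ = -∫ z, ⟪A₀ (fderiv ℝ (fun x => fderiv ℝ W x Complex.I) z 1), W z⟫_ℝ := by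
        congr 1; congr 1; ext z; rw [fderiv_fderiv_comm hW Complex.I 1 z]
    _ = ∫ z, ⟪A₀ (fderiv ℝ W z Complex.I), fderiv ℝ W z 1⟫_ℝ := hY.symm

end Calculus

/-! ### Assembly -/

/-- Integrated form of `H1Estimate.pointwise`: if `a b : ℂ → F` are continuous with compact
support and the cross term `∫ ⟪a, A₀ b⟫ - ⟪A₀ a, b⟫` vanishes, then
`∫ ‖b‖² + ‖a‖² ≤ (1 + ‖A₀‖²) ∫ ‖a - A₀ b‖²`. [folklore] -/
theorem integral_le (A₀ : F →L[ℝ] F) (hA₀ : ∀ v, A₀ (A₀ v) = -v) {a b : ℂ → F}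
    (ha : Continuous a) (hb : Continuous b) (hac : HasCompactSupport a)
    (hbc : HasCompactSupport b)
    (hcross : ∫ z, ⟪a z, A₀ (b z)⟫_ℝ = ∫ z, ⟪A₀ (a z), b z⟫_ℝ) :
    (∫ z, (‖b z‖ ^ 2 + ‖a z‖ ^ 2)) ≤ (1 + ‖A₀‖ ^ 2) * ∫ z, ‖a z - A₀ (b z)‖ ^ 2 := by
  have hi1 : Integrable fun z => ‖b z‖ ^ 2 + ‖a z‖ ^ 2 :=
    integrable_comp₂ hac hbc (fun x y => ‖y‖ ^ 2 + ‖x‖ ^ 2) (by fun_prop) (by simp)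
  have hi2 : Integrable fun z => ‖a z - A₀ (b z)‖ ^ 2 :=
    integrable_comp₂ hac hbc (fun x y => ‖x - A₀ y‖ ^ 2) (by fun_prop) (by simp)
  have hi3 : Integrable fun z => ⟪a z, A₀ (b z)⟫_ℝ :=
    integrable_comp₂ hac hbc (fun x y => ⟪x, A₀ y⟫_ℝ) (by fun_prop) (by simp)
  have hi4 : Integrable fun z => ⟪A₀ (a z), b z⟫_ℝ :=
    integrable_comp₂ hac hbc (fun x y => ⟪A₀ x, y⟫_ℝ) (by fun_prop) (by simp)
  calc ∫ z, (‖b z‖ ^ 2 + ‖a z‖ ^ 2)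
      ≤ ∫ z, ((1 + ‖A₀‖ ^ 2) * ‖a z - A₀ (b z)‖ ^ 2 +
          2 * (⟪a z, A₀ (b z)⟫_ℝ - ⟪A₀ (a z), b z⟫_ℝ)) :=
        integral_mono hi1 ((hi2.const_mul _).fun_add ((hi3.sub' hi4).const_mul _))
          fun z => pointwise A₀ hA₀ (a z) (b z)
    _ = ((1 + ‖A₀‖ ^ 2) * ∫ z, ‖a z - A₀ (b z)‖ ^ 2) +
          2 * ((∫ z, ⟪a z, A₀ (b z)⟫_ℝ) - ∫ z, ⟪A₀ (a z), b z⟫_ℝ) := by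
        rw [integral_add (hi2.const_mul _) ((hi3.sub' hi4).const_mul _), integral_const_mul,
          integral_const_mul, integral_sub hi3 hi4]
    _ = (1 + ‖A₀‖ ^ 2) * ∫ z, ‖a z - A₀ (b z)‖ ^ 2 := by
        rw [hcross, sub_self, mul_zero, add_zero]

end H1Estimate

/-- **The constant-coefficient `H¹` identity for the linear Cauchy–Riemann operator.** For a
constant `A₀ : ℝ⁴ → ℝ⁴` with `A₀² = -1` and a compactly supported `C^∞` map `W : ℂ → ℝ⁴`, with
`∂₁ = ∂/∂x = d·(1)` and `∂₂ = ∂/∂y = d·(i)`: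
`∫ ‖∂₁W‖² + ‖∂₂W‖² ≤ (1 + ‖A₀‖²) ∫ ‖∂₂W - A₀ ∂₁W‖²`.
Proof: integrate the pointwise inequality `H1Estimate.pointwise` (with `a = ∂₂W(z)`,
`b = ∂₁W(z)`); the cross term `∫ ⟪∂₂W, A₀ ∂₁W⟫ - ⟪A₀ ∂₂W, ∂₁W⟫` vanishes by two integrations
by parts and the symmetry of second derivatives (`H1Estimate.cross_eq`). [folklore] -/
theorem stub_h1Estimate (A₀ : (EuclideanSpace ℝ (Fin d)) →L[ℝ] (EuclideanSpace ℝ (Fin d))) (hA₀ : ∀ v, A₀ (A₀ v) = -v) (W : ℂ → (EuclideanSpace ℝ (Fin d)))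
    (hW : ContDiff ℝ ∞ W) (hWc : HasCompactSupport W) :
    (∫ z, (‖fderiv ℝ W z 1‖ ^ 2 + ‖fderiv ℝ W z Complex.I‖ ^ 2)) ≤
      (1 + ‖A₀‖ ^ 2) * ∫ z, ‖fderiv ℝ W z Complex.I - A₀ (fderiv ℝ W z 1)‖ ^ 2 :=
  H1Estimate.integral_le A₀ hA₀ (H1Estimate.continuous_fderiv_apply hW Complex.I)
    (H1Estimate.continuous_fderiv_apply hW 1) (hWc.fderiv_apply ℝ Complex.I)
    (hWc.fderiv_apply ℝ 1) (H1Estimate.cross_eq A₀ hW hWc)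

end Literature.Geometry.Symplectic.JHolomorphicWeierstrassProof

/-!
## Part `SullivanDualTameOrBrodyR4StubLadyzhenskaya`:
### Stub `stub_ladyzhenskaya` of line `Sketch` for crux `TameOrBrodyR4` (stmt-SmoothPoincare4-7826, route SullivanDual)

Ladyzhenskaya's inequality on `ℂ = ℝ²` for compactly supported smooth maps `W : ℂ → ℝ⁴`:
`∫ ‖W‖⁴ ≤ C (∫ ‖W‖²) (∫ ‖∂₁W‖² + ‖∂₂W‖²)` with `∂₁ = d·(1)`, `∂₂ = d·(I)`, for a constant `C`
depending on nothing (we take `C = 8 C₂` with `C₂` Mathlib's Gagliardo–Nirenberg–Sobolev constant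
`MeasureTheory.lintegralPowLePowLIntegralFDerivConst volume 2` on `ℂ`).

Proof outline (everything is done with lower Lebesgue integrals in `ℝ≥0∞` and converted to Bochner
integrals at the very end):

* the real function `u := ‖W‖²` is `C¹` with compact support, so Mathlib's
  Gagliardo–Nirenberg–Sobolev inequality `MeasureTheory.lintegral_pow_le_pow_lintegral_fderiv`
  on `ℂ` (`finrank ℝ ℂ = 2`, Hölder conjugate exponent `2`) gives
  `∫ ‖W‖⁴ = ∫ |u|² ≤ C₂ (∫ ‖∇u‖)²` (`Ladyzhenskaya.lintegral_norm_pow_four_le`);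
* pointwise `‖∇u‖ ≤ 2 ‖W‖ ‖∇W‖` (`HasFDerivAt.norm_sq`, `Ladyzhenskaya.enorm_fderiv_norm_sq_le`),
  and the Cauchy–Schwarz inequality (`ENNReal.lintegral_mul_le_Lp_mul_Lq` with `p = q = 2`) gives
  `(∫ ‖W‖ ‖∇W‖)² ≤ (∫ ‖W‖²) (∫ ‖∇W‖²)`;
* a real-linear map `T` on `ℂ` satisfies `‖T‖ ≤ ‖T 1‖ + ‖T I‖`
  (`Ladyzhenskaya.opNorm_le_norm_one_add_norm_I`), hence `‖∇W‖² ≤ 2 (‖∂₁W‖² + ‖∂₂W‖²)`;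
* all integrands are continuous with compact support, so the integrals are finite and the
  `ℝ≥0∞`-inequality transfers to real integrals.

Folklore (Ladyzhenskaya 1958; Gagliardo 1958 / Nirenberg 1959).
-/

open scoped ContDiff Topology ENNReal NNReal
open Filter Set MeasureTheory

namespace Literature.Geometry.Symplectic.JHolomorphicWeierstrassProof

variable {d : ℕ}
namespace Ladyzhenskaya

variable {F : Type*} [NormedAddCommGroup F] [NormedSpace ℝ F]

/-- A continuous real-linear map on `ℂ` is controlled by its values at `1` and `I`:
`‖T‖ ≤ ‖T 1‖ + ‖T I‖`. [folklore] -/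
theorem opNorm_le_norm_one_add_norm_I (T : ℂ →L[ℝ] F) : ‖T‖ ≤ ‖T 1‖ + ‖T Complex.I‖ := by
  refine ContinuousLinearMap.opNorm_le_bound _ (by positivity) fun v => ?_
  have hv : v = v.re • (1 : ℂ) + v.im • Complex.I := by
    rw [Complex.real_smul, Complex.real_smul, mul_one, Complex.re_add_im]
  calc ‖T v‖ = ‖T (v.re • (1 : ℂ) + v.im • Complex.I)‖ := by rw [← hv]
    _ = ‖v.re • T 1 + v.im • T Complex.I‖ := by rw [map_add, map_smul, map_smul]
    _ ≤ ‖v.re • T 1‖ + ‖v.im • T Complex.I‖ := norm_add_le _ _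
    _ = |v.re| * ‖T 1‖ + |v.im| * ‖T Complex.I‖ := by
        rw [norm_smul, norm_smul, Real.norm_eq_abs, Real.norm_eq_abs]
    _ ≤ ‖v‖ * ‖T 1‖ + ‖v‖ * ‖T Complex.I‖ := by
        gcongr
        · exact Complex.abs_re_le_norm v
        · exact Complex.abs_im_le_norm v
    _ = (‖T 1‖ + ‖T Complex.I‖) * ‖v‖ := by ring

/-- Squared `ℝ≥0∞` version of `opNorm_le_norm_one_add_norm_I`:
`‖T‖² ≤ 2 (‖T 1‖² + ‖T I‖²)`. [folklore] -/
theorem enorm_sq_le (T : ℂ →L[ℝ] F) :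
    ‖T‖ₑ ^ 2 ≤ 2 * (‖T 1‖ₑ ^ 2 + ‖T Complex.I‖ₑ ^ 2) := by
  have h1 := opNorm_le_norm_one_add_norm_I T
  have h : ‖T‖ ^ 2 ≤ 2 * (‖T 1‖ ^ 2 + ‖T Complex.I‖ ^ 2) := by
    nlinarith [norm_nonneg T, norm_nonneg (T 1), norm_nonneg (T Complex.I),
      sq_nonneg (‖T 1‖ - ‖T Complex.I‖)]
  calc ‖T‖ₑ ^ 2 = ENNReal.ofReal (‖T‖ ^ 2) := by
        rw [ENNReal.ofReal_pow (norm_nonneg _), ofReal_norm]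
    _ ≤ ENNReal.ofReal (2 * (‖T 1‖ ^ 2 + ‖T Complex.I‖ ^ 2)) := ENNReal.ofReal_le_ofReal h
    _ = 2 * (‖T 1‖ₑ ^ 2 + ‖T Complex.I‖ₑ ^ 2) := by
        rw [ENNReal.ofReal_mul zero_le_two, ENNReal.ofReal_add (by positivity) (by positivity),
          ENNReal.ofReal_pow (norm_nonneg _), ENNReal.ofReal_pow (norm_nonneg _), ofReal_norm,
          ofReal_norm, ENNReal.ofReal_ofNat]

/-- The derivative of `‖W‖²` is bounded by `2 ‖W‖ ‖dW‖` (in `ℝ≥0∞`). [folklore] -/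
theorem enorm_fderiv_norm_sq_le {W : ℂ → (EuclideanSpace ℝ (Fin d))} (hW : Differentiable ℝ W) (z : ℂ) :
    ‖fderiv ℝ (fun z => ‖W z‖ ^ 2) z‖ₑ ≤ 2 * (‖W z‖ₑ * ‖fderiv ℝ W z‖ₑ) := by
  have h : ‖fderiv ℝ (fun z => ‖W z‖ ^ 2) z‖ ≤ 2 * (‖W z‖ * ‖fderiv ℝ W z‖) := by
    rw [(hW z).hasFDerivAt.norm_sq.fderiv]
    calc ‖(2 • (innerSL ℝ (W z)).comp (fderiv ℝ W z))‖
        ≤ 2 * ‖(innerSL ℝ (W z)).comp (fderiv ℝ W z)‖ := by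
          rw [two_smul]
          exact (norm_add_le _ _).trans_eq (two_mul _).symm
      _ ≤ 2 * (‖innerSL ℝ (W z)‖ * ‖fderiv ℝ W z‖) := by
          gcongr
          exact ContinuousLinearMap.opNorm_comp_le _ _
      _ = 2 * (‖W z‖ * ‖fderiv ℝ W z‖) := by rw [innerSL_apply_norm]
  calc ‖fderiv ℝ (fun z => ‖W z‖ ^ 2) z‖ₑ
      = ENNReal.ofReal ‖fderiv ℝ (fun z => ‖W z‖ ^ 2) z‖ := (ofReal_norm _).symm
    _ ≤ ENNReal.ofReal (2 * (‖W z‖ * ‖fderiv ℝ W z‖)) := ENNReal.ofReal_le_ofReal h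
    _ = 2 * (‖W z‖ₑ * ‖fderiv ℝ W z‖ₑ) := by
        rw [ENNReal.ofReal_mul zero_le_two, ENNReal.ofReal_mul (norm_nonneg _), ofReal_norm,
          ofReal_norm, ENNReal.ofReal_ofNat]

/-- **Ladyzhenskaya's inequality in `ℝ≥0∞` form.** For a compactly supported `C^∞` map
`W : ℂ → ℝ⁴`: `∫⁻ ‖W‖⁴ ≤ 8 C₂ (∫⁻ ‖W‖²) (∫⁻ ‖∂₁W‖² + ‖∂₂W‖²)`, where `C₂` is the
Gagliardo–Nirenberg–Sobolev constant of `ℂ` for the exponent `2`. [folklore] -/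
theorem lintegral_norm_pow_four_le {W : ℂ → (EuclideanSpace ℝ (Fin d))} (hW : ContDiff ℝ ∞ W)
    (hWc : HasCompactSupport W) :
    ∫⁻ z, ‖W z‖ₑ ^ 4 ≤
      ((8 * lintegralPowLePowLIntegralFDerivConst (volume : Measure ℂ) 2 : ℝ≥0) : ℝ≥0∞) *
        ((∫⁻ z, ‖W z‖ₑ ^ 2) *
          ∫⁻ z, (‖fderiv ℝ W z 1‖ₑ ^ 2 + ‖fderiv ℝ W z Complex.I‖ₑ ^ 2)) := by
  set C := lintegralPowLePowLIntegralFDerivConst (volume : Measure ℂ) 2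
  set u : ℂ → ℝ := fun z => ‖W z‖ ^ 2 with hu_def
  have hu : ContDiff ℝ 1 u := (hW.norm_sq ℝ).of_le (mod_cast le_top)
  have h2u : HasCompactSupport u := hWc.comp_left (g := fun v : (EuclideanSpace ℝ (Fin d)) => ‖v‖ ^ 2) (by simp)
  have hp : Real.HolderConjugate (Module.finrank ℝ ℂ : ℝ) 2 := by
    rw [Complex.finrank_real_complex, Nat.cast_ofNat]
    exact Real.HolderConjugate.two_two
  have hGNS := lintegral_pow_le_pow_lintegral_fderiv (volume : Measure ℂ) hu h2u hp
  have hWd : Differentiable ℝ W := hW.differentiable (by simp)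
  have hWm : AEMeasurable (fun z => ‖W z‖ₑ) (volume : Measure ℂ) :=
    hW.continuous.enorm.aemeasurable
  have hdWm : AEMeasurable (fun z => ‖fderiv ℝ W z‖ₑ) (volume : Measure ℂ) :=
    (hW.continuous_fderiv (by simp)).enorm.aemeasurable
  -- Step 1: the left-hand side is `∫⁻ |u|²`.
  have h1 : ∫⁻ z, ‖W z‖ₑ ^ 4 = ∫⁻ x, ‖u x‖ₑ ^ (2 : ℝ) := by
    refine lintegral_congr fun z => ?_
    rw [ENNReal.rpow_two, hu_def]
    simp only
    rw [Real.enorm_eq_ofReal (by positivity), ENNReal.ofReal_pow (norm_nonneg _), ofReal_norm,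
      ← pow_mul]
  -- Step 2: `∫⁻ ‖∇u‖ ≤ 2 ∫⁻ ‖W‖ ‖∇W‖`.
  have h2 : ∫⁻ x, ‖fderiv ℝ u x‖ₑ ≤ 2 * ∫⁻ z, ‖W z‖ₑ * ‖fderiv ℝ W z‖ₑ := by
    rw [← lintegral_const_mul' _ _ ENNReal.ofNat_ne_top]
    exact lintegral_mono fun z => enorm_fderiv_norm_sq_le hWd z
  -- Step 3: Cauchy–Schwarz.
  have h3 : (∫⁻ z, ‖W z‖ₑ * ‖fderiv ℝ W z‖ₑ) ^ 2 ≤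
      (∫⁻ z, ‖W z‖ₑ ^ 2) * ∫⁻ z, ‖fderiv ℝ W z‖ₑ ^ 2 := by
    have hCS := ENNReal.lintegral_mul_le_Lp_mul_Lq volume Real.HolderConjugate.two_two hWm hdWm
    simp only [Pi.mul_apply, ENNReal.rpow_two] at hCS
    calc (∫⁻ z, ‖W z‖ₑ * ‖fderiv ℝ W z‖ₑ) ^ 2
        ≤ ((∫⁻ z, ‖W z‖ₑ ^ 2) ^ (1 / 2 : ℝ) * (∫⁻ z, ‖fderiv ℝ W z‖ₑ ^ 2) ^ (1 / 2 : ℝ)) ^ 2 := by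
          gcongr
      _ = (∫⁻ z, ‖W z‖ₑ ^ 2) * ∫⁻ z, ‖fderiv ℝ W z‖ₑ ^ 2 := by
          rw [mul_pow, ← ENNReal.rpow_two, ← ENNReal.rpow_two, ← ENNReal.rpow_mul,
            ← ENNReal.rpow_mul]
          norm_num
  -- Step 4: `‖∇W‖² ≤ 2 (‖∂₁W‖² + ‖∂₂W‖²)`.
  have h4 : ∫⁻ z, ‖fderiv ℝ W z‖ₑ ^ 2 ≤
      2 * ∫⁻ z, (‖fderiv ℝ W z 1‖ₑ ^ 2 + ‖fderiv ℝ W z Complex.I‖ₑ ^ 2) := by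
    rw [← lintegral_const_mul' _ _ ENNReal.ofNat_ne_top]
    exact lintegral_mono fun z => enorm_sq_le (fderiv ℝ W z)
  calc ∫⁻ z, ‖W z‖ₑ ^ 4 = ∫⁻ x, ‖u x‖ₑ ^ (2 : ℝ) := h1
    _ ≤ C * (∫⁻ x, ‖fderiv ℝ u x‖ₑ) ^ (2 : ℝ) := hGNS
    _ = C * (∫⁻ x, ‖fderiv ℝ u x‖ₑ) ^ 2 := by rw [ENNReal.rpow_two]
    _ ≤ C * (2 * ∫⁻ z, ‖W z‖ₑ * ‖fderiv ℝ W z‖ₑ) ^ 2 := by gcongr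
    _ = C * 4 * (∫⁻ z, ‖W z‖ₑ * ‖fderiv ℝ W z‖ₑ) ^ 2 := by ring
    _ ≤ C * 4 * ((∫⁻ z, ‖W z‖ₑ ^ 2) * ∫⁻ z, ‖fderiv ℝ W z‖ₑ ^ 2) := by gcongr
    _ ≤ C * 4 * ((∫⁻ z, ‖W z‖ₑ ^ 2) *
        (2 * ∫⁻ z, (‖fderiv ℝ W z 1‖ₑ ^ 2 + ‖fderiv ℝ W z Complex.I‖ₑ ^ 2))) := by gcongr
    _ = ((8 * C : ℝ≥0) : ℝ≥0∞) * ((∫⁻ z, ‖W z‖ₑ ^ 2) *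
        ∫⁻ z, (‖fderiv ℝ W z 1‖ₑ ^ 2 + ‖fderiv ℝ W z Complex.I‖ₑ ^ 2)) := by
      push_cast
      ring

/-- The integral of `‖W‖ ^ n` is the real part of the lower Lebesgue integral of `‖W‖ₑ ^ n`. [folklore] -/
theorem integral_norm_pow_eq {W : ℂ → (EuclideanSpace ℝ (Fin d))} (hW : Continuous W) (n : ℕ) :
    ∫ z, ‖W z‖ ^ n = (∫⁻ z, ‖W z‖ₑ ^ n).toReal := by
  rw [integral_eq_lintegral_of_nonneg_ae (f := fun z => ‖W z‖ ^ n)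
    (Eventually.of_forall fun z => by positivity) (by fun_prop)]
  congr 1
  refine lintegral_congr fun z => ?_
  rw [ENNReal.ofReal_pow (norm_nonneg _), ofReal_norm]

/-- Finiteness of `∫⁻ ‖W‖ₑ ^ n` for a continuous compactly supported `W`. [folklore] -/
theorem lintegral_norm_pow_lt_top {W : ℂ → (EuclideanSpace ℝ (Fin d))} (hW : Continuous W) (hWc : HasCompactSupport W)
    {n : ℕ} (hn : n ≠ 0) : ∫⁻ z, ‖W z‖ₑ ^ n < ⊤ := by
  have hi : Integrable (fun z => ‖W z‖ ^ n) (volume : Measure ℂ) :=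
    (hW.norm.pow n).integrable_of_hasCompactSupport
      (hWc.comp_left (g := fun v : (EuclideanSpace ℝ (Fin d)) => ‖v‖ ^ n) (by simp [hn]))
  have hfi := hi.hasFiniteIntegral
  rw [hasFiniteIntegral_iff_enorm] at hfi
  refine lt_of_eq_of_lt (lintegral_congr fun z => ?_) hfi
  rw [Real.enorm_eq_ofReal (by positivity), ENNReal.ofReal_pow (norm_nonneg _), ofReal_norm]

end Ladyzhenskaya

/-- **Stub `stub_ladyzhenskaya` (Ladyzhenskaya's inequality on `ℝ²`).** There is a constant `C`
such that for every compactly supported `C^∞` map `W : ℂ → ℝ⁴`,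
`∫ ‖W‖⁴ ≤ C (∫ ‖W‖²) (∫ ‖∂₁W‖² + ‖∂₂W‖²)`, where `∂₁W = dW(1)` and `∂₂W = dW(I)`.
Proof: `Ladyzhenskaya.lintegral_norm_pow_four_le` (Gagliardo–Nirenberg–Sobolev for `‖W‖²` +
Cauchy–Schwarz), transferred from `ℝ≥0∞` to real integrals (all integrands are continuous with
compact support, hence integrable). [folklore] -/
theorem stub_ladyzhenskaya : ∃ C : ℝ, ∀ (W : ℂ → (EuclideanSpace ℝ (Fin d))), ContDiff ℝ ∞ W → HasCompactSupport W →
    (∫ z, ‖W z‖ ^ 4) ≤ C * ((∫ z, ‖W z‖ ^ 2) *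
      ∫ z, (‖fderiv ℝ W z 1‖ ^ 2 + ‖fderiv ℝ W z Complex.I‖ ^ 2)) := by
  refine ⟨((8 * lintegralPowLePowLIntegralFDerivConst (volume : Measure ℂ) 2 : ℝ≥0) : ℝ),
    fun W hW hWc => ?_⟩
  have hmain := Ladyzhenskaya.lintegral_norm_pow_four_le hW hWc
  have hd1 : Continuous fun z => fderiv ℝ W z 1 :=
    (hW.continuous_fderiv (by simp)).clm_apply continuous_const
  have hdI : Continuous fun z => fderiv ℝ W z Complex.I :=
    (hW.continuous_fderiv (by simp)).clm_apply continuous_const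
  -- the three real integrals as lower Lebesgue integrals
  have hA : ∫ z, ‖W z‖ ^ 4 = (∫⁻ z, ‖W z‖ₑ ^ 4).toReal :=
    Ladyzhenskaya.integral_norm_pow_eq hW.continuous 4
  have hB : ∫ z, ‖W z‖ ^ 2 = (∫⁻ z, ‖W z‖ₑ ^ 2).toReal :=
    Ladyzhenskaya.integral_norm_pow_eq hW.continuous 2
  have hD : ∫ z, (‖fderiv ℝ W z 1‖ ^ 2 + ‖fderiv ℝ W z Complex.I‖ ^ 2) =
      (∫⁻ z, (‖fderiv ℝ W z 1‖ₑ ^ 2 + ‖fderiv ℝ W z Complex.I‖ₑ ^ 2)).toReal := by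
    rw [integral_eq_lintegral_of_nonneg_ae
      (f := fun z => ‖fderiv ℝ W z 1‖ ^ 2 + ‖fderiv ℝ W z Complex.I‖ ^ 2)
      (Eventually.of_forall fun z => by positivity) (by fun_prop)]
    congr 1
    refine lintegral_congr fun z => ?_
    rw [ENNReal.ofReal_add (by positivity) (by positivity), ENNReal.ofReal_pow (norm_nonneg _),
      ENNReal.ofReal_pow (norm_nonneg _), ofReal_norm, ofReal_norm]
  -- finiteness
  have hBfin : ∫⁻ z, ‖W z‖ₑ ^ 2 < ⊤ :=
    Ladyzhenskaya.lintegral_norm_pow_lt_top hW.continuous hWc two_ne_zero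
  have hDfin : ∫⁻ z, (‖fderiv ℝ W z 1‖ₑ ^ 2 + ‖fderiv ℝ W z Complex.I‖ₑ ^ 2) < ⊤ := by
    rw [lintegral_add_left (hd1.enorm.measurable.pow_const 2)]
    exact ENNReal.add_lt_top.mpr
      ⟨Ladyzhenskaya.lintegral_norm_pow_lt_top hd1 (hWc.fderiv_apply (𝕜 := ℝ) 1) two_ne_zero,
        Ladyzhenskaya.lintegral_norm_pow_lt_top hdI (hWc.fderiv_apply (𝕜 := ℝ) Complex.I)
          two_ne_zero⟩
  rw [hA, hB, hD, ← ENNReal.coe_toReal, ← ENNReal.toReal_mul, ← ENNReal.toReal_mul]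
  exact ENNReal.toReal_mono
    (ENNReal.mul_ne_top ENNReal.coe_ne_top (ENNReal.mul_ne_top hBfin.ne hDfin.ne)) hmain

end Literature.Geometry.Symplectic.JHolomorphicWeierstrassProof

/-!
## Part `SullivanDualTameOrBrodyR4StubNormIteratedFDerivLe`:
### Stub `stub_normIteratedFDerivLe` of line `Sketch` for crux `TameOrBrodyR4` (stmt-SmoothPoincare4-7826, route SullivanDual)

An elementary bridge between the operator norm of an `ℝ`-multilinear map on `ℂⁿ` and its values
on basis tuples: for a continuous `ℝ`-multilinear `T : ℂⁿ → F` (in the stub, `F = ℝ⁴`),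

  `‖T‖ ≤ ∑_{L : Fin n → Fin 2} ‖T (e_{L 0}, …, e_{L (n-1)})‖`, with `e₀ = 1`, `e₁ = i`.

Proof: expand every argument along the real basis `(1, i)` of `ℂ`,
`v j = (re v j) • 1 + (im v j) • i`, use multilinearity (`ContinuousMultilinearMap.map_sum`,
`ContinuousMultilinearMap.map_smul_univ`) to get
`T v = ∑_L (∏ j, c_{L j} (v j)) • T (e ∘ L)` with `c₀ = re`, `c₁ = im`, bound
`|re w|, |im w| ≤ ‖w‖`, and conclude with `ContinuousMultilinearMap.opNorm_le_bound`.
The lead uses it with `T = iteratedFDeriv ℝ n g z` to pass from directional ("word") derivatives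
of a map `g : ℂ → ℝ⁴` to the norm of its `n`-th Fréchet derivative.
-/

open scoped ContDiff Topology
open Filter Set

namespace Literature.Geometry.Symplectic.JHolomorphicWeierstrassProof

variable {d : ℕ}
namespace NormIteratedFDerivLe

variable {F : Type*} [NormedAddCommGroup F] [NormedSpace ℝ F]

/-- Every complex number is `re v • 1 + im v • i`, written as a sum over `Fin 2` against the
real basis `![1, i]` with coefficients `![re v, im v]`. [folklore] -/
theorem sum_reIm_smul (v : ℂ) :
    ∑ i : Fin 2, (![v.re, v.im] i) • ![(1 : ℂ), Complex.I] i = v := by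
  rw [Fin.sum_univ_two]
  show v.re • (1 : ℂ) + v.im • Complex.I = v
  rw [Complex.real_smul, Complex.real_smul, mul_one, Complex.re_add_im]

/-- The real coordinates `re v`, `im v` of a complex number are bounded by its norm. [folklore] -/
theorem abs_reIm_le (v : ℂ) (i : Fin 2) : |![v.re, v.im] i| ≤ ‖v‖ := by
  fin_cases i
  exacts [Complex.abs_re_le_norm v, Complex.abs_im_le_norm v]

/-- Expansion of a continuous `ℝ`-multilinear map on `ℂⁿ` along the real basis `(1, i)` in every
slot: `T v = ∑_L (∏ j, c_{L j} (v j)) • T (e ∘ L)`. [folklore] -/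
theorem apply_eq_sum {n : ℕ} (T : ContinuousMultilinearMap ℝ (fun _ : Fin n => ℂ) F)
    (v : Fin n → ℂ) :
    T v = ∑ L : Fin n → Fin 2,
      (∏ j, ![(v j).re, (v j).im] (L j)) • T (fun j => ![(1 : ℂ), Complex.I] (L j)) := by
  have hv : v = fun j => ∑ i : Fin 2, (![(v j).re, (v j).im] i) • ![(1 : ℂ), Complex.I] i :=
    funext fun j => (sum_reIm_smul (v j)).symm
  have hT : T v = T (fun j => ∑ i : Fin 2, (![(v j).re, (v j).im] i) • ![(1 : ℂ), Complex.I] i) :=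
    congrArg T hv
  rw [hT, ContinuousMultilinearMap.map_sum T
    (fun j (i : Fin 2) => (![(v j).re, (v j).im] i) • ![(1 : ℂ), Complex.I] i)]
  exact Finset.sum_congr rfl fun L _ =>
    T.map_smul_univ (fun j => ![(v j).re, (v j).im] (L j)) (fun j => ![(1 : ℂ), Complex.I] (L j))

/-- Pointwise bound: `‖T v‖ ≤ (∑_L ‖T (e ∘ L)‖) * ∏ j, ‖v j‖`. [folklore] -/
theorem norm_apply_le {n : ℕ} (T : ContinuousMultilinearMap ℝ (fun _ : Fin n => ℂ) F)
    (v : Fin n → ℂ) :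
    ‖T v‖ ≤ (∑ L : Fin n → Fin 2, ‖T (fun j => ![(1 : ℂ), Complex.I] (L j))‖) * ∏ j, ‖v j‖ := by
  rw [apply_eq_sum T v, Finset.sum_mul]
  refine (norm_sum_le _ _).trans (Finset.sum_le_sum fun L _ => ?_)
  rw [norm_smul, Real.norm_eq_abs, Finset.abs_prod]
  exact (mul_le_mul_of_nonneg_right
    (Finset.prod_le_prod (fun j _ => abs_nonneg _) fun j _ => abs_reIm_le (v j) (L j))
    (norm_nonneg _)).trans_eq (mul_comm _ _)

/-- Operator-norm bound for a continuous `ℝ`-multilinear map on `ℂⁿ` with values in any real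
normed space: `‖T‖ ≤ ∑_{L : Fin n → Fin 2} ‖T (e ∘ L)‖`, `e = ![1, i]`. [folklore] -/
theorem opNorm_le_sum {n : ℕ} (T : ContinuousMultilinearMap ℝ (fun _ : Fin n => ℂ) F) :
    ‖T‖ ≤ ∑ L : Fin n → Fin 2, ‖T (fun j => ![(1 : ℂ), Complex.I] (L j))‖ :=
  ContinuousMultilinearMap.opNorm_le_bound (Finset.sum_nonneg fun _ _ => norm_nonneg _)
    (norm_apply_le T)

end NormIteratedFDerivLe

/-- **Stub (worker; a multilinear map on `ℂⁿ` is controlled by its values on basis tuples).**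
For a continuous `ℝ`-multilinear `T : ℂⁿ → ℝ⁴`, `‖T‖ ≤ ∑_{L : Fin n → Fin 2} ‖T(e_{L 0}, …)‖`
with `e₀ = 1`, `e₁ = i`. Proof: expand each argument `v j = (re v j) • 1 + (im v j) • i`
(`ContinuousMultilinearMap.map_sum`, `map_smul_univ`), bound `|re v j|, |im v j| ≤ ‖v j‖`, and
conclude with `ContinuousMultilinearMap.opNorm_le_bound`
(see `NormIteratedFDerivLe.opNorm_le_sum` for a general real normed target). [folklore] -/
theorem stub_normIteratedFDerivLe (n : ℕ) (T : ContinuousMultilinearMap ℝ (fun _ : Fin n => ℂ) (EuclideanSpace ℝ (Fin d))) :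
    ‖T‖ ≤ ∑ L : Fin n → Fin 2, ‖T (fun j => ![(1 : ℂ), Complex.I] (L j))‖ := by
  exact NormIteratedFDerivLe.opNorm_le_sum T

end Literature.Geometry.Symplectic.JHolomorphicWeierstrassProof

/-!
## Part `SullivanDualTameOrBrodyR4StubSupBound`:
### Stub `stub_supBound` of line `Sketch` for crux `TameOrBrodyR4` (stmt-SmoothPoincare4-7826, route SullivanDual)

Sup bound by the `L¹` norm of the mixed second derivative: for a compactly supported `C^∞` map
`W : ℂ → ℝ⁴` and every `z`, `‖W z‖ ≤ ∫ ‖∂₂∂₁W‖`, where `∂₁U = dU(·) 1` and `∂₂U = dU(·) i`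
(the case `n = 2`, `p = 1` of the point embedding `W^{n,1} ↪ C⁰`). Proof (fundamental theorem
of calculus twice and Tonelli, carried out in `ℝ≥0∞` so that no integrability is needed before
the last line):

* `SupBound.enorm_le_lintegral_line` — the one-dimensional step along a line `t ↦ a + t • v`
  (`v ≠ 0`) for a `C¹` compactly supported `F : ℂ → E`:
  `‖F (a + t₀ • v)‖ₑ ≤ ∫⁻ t, ‖dF(a + t • v) v‖ₑ` (Mathlib's
  `HasCompactSupport.enorm_le_lintegral_Ici_deriv`, the chain rule, and the closed embedding
  `t ↦ a + t • v` for the compact support of the restriction);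
* the step is applied to `W` along the horizontal line through `z`, then to `∂₁W` along every
  vertical line; `lintegral_mono`, Tonelli on `ℝ × ℝ` (`MeasureTheory.lintegral_prod`) and the
  measure-preserving equivalence `Complex.measurableEquivRealProd`
  (`Complex.volume_preserving_equiv_real_prod`) identify the iterated integral with `∫⁻ ‖∂₂∂₁W‖ₑ`
  over `ℂ`;
* back to the Bochner integral with `MeasureTheory.ofReal_integral_norm_eq_lintegral_enorm`
  (`∂₂∂₁W` is continuous with compact support, hence integrable).

Folklore (e.g. Adams 1975, *Sobolev Spaces*, Lemma 5.15; the `ℝ≥0∞` bookkeeping follows the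
project file `Literature/Analysis/OperatorTheory/SobolevPointBound.lean`).
-/

open scoped ContDiff Topology ENNReal
open Filter Set MeasureTheory Topology

namespace Literature.Geometry.Symplectic.JHolomorphicWeierstrassProof

variable {d : ℕ}
namespace SupBound

variable {E : Type*} [NormedAddCommGroup E] [NormedSpace ℝ E]

/-- The real line `t ↦ a + t • v` through `a` in the direction `v ≠ 0` is a closed embedding
`ℝ → ℂ`. [folklore] -/
theorem isClosedEmbedding_line (a : ℂ) {v : ℂ} (hv : v ≠ 0) :
    IsClosedEmbedding fun t : ℝ => a + t • v :=
  (Homeomorph.addLeft a).isClosedEmbedding.comp (isClosedEmbedding_smul_left hv)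

/-- The real line `t ↦ a + t • v` has derivative `v`. [folklore] -/
theorem hasDerivAt_line (a v : ℂ) (t : ℝ) : HasDerivAt (fun t : ℝ => a + t • v) v t := by
  simpa only [one_smul] using ((hasDerivAt_id' t).smul_const v).const_add a

/-- **One-dimensional step along a line.** For a `C¹` compactly supported `F : ℂ → E`, a point
`a`, a direction `v ≠ 0` and a parameter `t₀`:
`‖F (a + t₀ • v)‖ₑ ≤ ∫⁻ t, ‖dF(a + t • v) v‖ₑ` (fundamental theorem of calculus on `(-∞, t₀]`). [folklore] -/
theorem enorm_le_lintegral_line {F : ℂ → E} (hF : ContDiff ℝ 1 F) (hFc : HasCompactSupport F)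
    (a : ℂ) {v : ℂ} (hv : v ≠ 0) (t₀ : ℝ) :
    ‖F (a + t₀ • v)‖ₑ ≤ ∫⁻ t : ℝ, ‖fderiv ℝ F (a + t • v) v‖ₑ := by
  have hf : ContDiff ℝ 1 fun t : ℝ => F (a + t • v) :=
    hF.comp (contDiff_const.add (contDiff_id.smul contDiff_const))
  have hfc : HasCompactSupport fun t : ℝ => F (a + t • v) :=
    hFc.comp_isClosedEmbedding (isClosedEmbedding_line a hv)
  have hderiv : ∀ t, deriv (fun t : ℝ => F (a + t • v)) t = fderiv ℝ F (a + t • v) v := fun t =>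
    ((hF.differentiable one_ne_zero (a + t • v)).hasFDerivAt.comp_hasDerivAt t
      (hasDerivAt_line a v t)).deriv
  calc ‖F (a + t₀ • v)‖ₑ = ‖(fun t : ℝ => F (a + t • v)) t₀‖ₑ := rfl
    _ ≤ ∫⁻ t in Iic t₀, ‖deriv (fun t : ℝ => F (a + t • v)) t‖ₑ :=
        hfc.enorm_le_lintegral_Ici_deriv hf t₀
    _ ≤ ∫⁻ t : ℝ, ‖deriv (fun t : ℝ => F (a + t • v)) t‖ₑ := setLIntegral_le_lintegral _ _
    _ = ∫⁻ t : ℝ, ‖fderiv ℝ F (a + t • v) v‖ₑ := by simp only [hderiv]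

end SupBound

/-- **Sup bound by the `L¹` norm of the mixed second derivative.** For a compactly supported
`C^∞` map `W : ℂ → ℝ⁴` and every `z`: `‖W z‖ ≤ ∫ ‖∂₂∂₁W‖`, where `∂₁W = dW(·) 1` and
`∂₂V = dV(·) i`. Proof: the one-dimensional step `SupBound.enorm_le_lintegral_line` along the
horizontal line through `z` (for `W`) and along every vertical line (for `∂₁W`), then Tonelli on
`ℂ ≃ ℝ × ℝ` (`Complex.volume_preserving_equiv_real_prod`). [folklore] -/
theorem stub_supBound (W : ℂ → (EuclideanSpace ℝ (Fin d))) (hW : ContDiff ℝ ∞ W) (hWc : HasCompactSupport W) (z : ℂ) :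
    ‖W z‖ ≤ ∫ y, ‖fderiv ℝ (fun x => fderiv ℝ W x 1) y Complex.I‖ := by
  -- `V = ∂₁W` is smooth with compact support, and `∂₂V = ∂₂∂₁W` is continuous with compact support
  set V : ℂ → (EuclideanSpace ℝ (Fin d)) := fun x => fderiv ℝ W x 1 with hV_def
  have hV : ContDiff ℝ ∞ V := (contDiff_infty_iff_fderiv.mp hW).2.clm_apply contDiff_const
  have hVc : HasCompactSupport V := hWc.fderiv_apply (𝕜 := ℝ) (v := 1)
  have hV₂ : Continuous fun y => fderiv ℝ V y Complex.I :=
    (contDiff_infty_iff_fderiv.mp hV).2.continuous.clm_apply continuous_const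
  have hV₂c : HasCompactSupport fun y => fderiv ℝ V y Complex.I :=
    hVc.fderiv_apply (𝕜 := ℝ) (v := Complex.I)
  have hint : Integrable fun y => fderiv ℝ V y Complex.I := hV₂.integrable_of_hasCompactSupport hV₂c
  -- (1) the horizontal line through `z`: `‖W z‖ ≤ ∫ ‖∂₁W (z.im i + s)‖ ds`
  have h1 : ‖W z‖ₑ ≤ ∫⁻ s : ℝ, ‖V (↑z.im * Complex.I + s • (1 : ℂ))‖ₑ := by
    have hz : (↑z.im * Complex.I + z.re • (1 : ℂ) : ℂ) = z := Complex.ext (by simp) (by simp)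
    calc ‖W z‖ₑ = ‖W (↑z.im * Complex.I + z.re • (1 : ℂ))‖ₑ := by rw [hz]
      _ ≤ ∫⁻ s : ℝ, ‖fderiv ℝ W (↑z.im * Complex.I + s • (1 : ℂ)) 1‖ₑ :=
          SupBound.enorm_le_lintegral_line (hW.of_le (by exact_mod_cast le_top)) hWc _
            one_ne_zero z.re
      _ = ∫⁻ s : ℝ, ‖V (↑z.im * Complex.I + s • (1 : ℂ))‖ₑ := rfl
  -- (2) the vertical lines: `‖∂₁W (z.im i + s)‖ ≤ ∫ ‖∂₂∂₁W (s + t i)‖ dt`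
  have h2 : ∀ s : ℝ, ‖V (↑z.im * Complex.I + s • (1 : ℂ))‖ₑ ≤
      ∫⁻ t : ℝ, ‖fderiv ℝ V (Complex.measurableEquivRealProd.symm (s, t)) Complex.I‖ₑ := by
    intro s
    have hs : (↑z.im * Complex.I + s • (1 : ℂ) : ℂ) = ↑s + z.im • Complex.I :=
      Complex.ext (by simp) (by simp)
    calc ‖V (↑z.im * Complex.I + s • (1 : ℂ))‖ₑ = ‖V (↑s + z.im • Complex.I)‖ₑ := by rw [hs]
      _ ≤ ∫⁻ t : ℝ, ‖fderiv ℝ V (↑s + t • Complex.I) Complex.I‖ₑ :=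
          SupBound.enorm_le_lintegral_line (hV.of_le (by exact_mod_cast le_top)) hVc _
            Complex.I_ne_zero z.im
      _ = ∫⁻ t : ℝ, ‖fderiv ℝ V (Complex.measurableEquivRealProd.symm (s, t)) Complex.I‖ₑ := by
          simp only [Complex.measurableEquivRealProd_symm_apply, Complex.mk_eq_add_mul_I,
            Complex.real_smul]
  -- (3) Tonelli on `ℝ × ℝ` and the measure-preserving equivalence `ℂ ≃ ℝ × ℝ`
  have h3 : ∫⁻ s : ℝ, ∫⁻ t : ℝ,
      ‖fderiv ℝ V (Complex.measurableEquivRealProd.symm (s, t)) Complex.I‖ₑ =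
        ∫⁻ y, ‖fderiv ℝ V y Complex.I‖ₑ := by
    have hmeas : Measurable fun y : ℂ => ‖fderiv ℝ V y Complex.I‖ₑ := hV₂.measurable.enorm
    have hmp : MeasurePreserving Complex.measurableEquivRealProd.symm :=
      Complex.volume_preserving_equiv_real_prod.symm _
    calc ∫⁻ s : ℝ, ∫⁻ t : ℝ,
        ‖fderiv ℝ V (Complex.measurableEquivRealProd.symm (s, t)) Complex.I‖ₑ
        = ∫⁻ p : ℝ × ℝ, ‖fderiv ℝ V (Complex.measurableEquivRealProd.symm p) Complex.I‖ₑ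
            ∂(volume : Measure ℝ).prod volume :=
          (lintegral_prod
            (fun p : ℝ × ℝ => ‖fderiv ℝ V (Complex.measurableEquivRealProd.symm p) Complex.I‖ₑ)
            (hmeas.comp Complex.measurableEquivRealProd.symm.measurable).aemeasurable).symm
      _ = ∫⁻ p : ℝ × ℝ, ‖fderiv ℝ V (Complex.measurableEquivRealProd.symm p) Complex.I‖ₑ := rfl
      _ = ∫⁻ y, ‖fderiv ℝ V y Complex.I‖ₑ := hmp.lintegral_comp hmeas
  -- (4) assemble in `ℝ≥0∞` and return to the Bochner integral
  have h4 : ‖W z‖ₑ ≤ ∫⁻ y, ‖fderiv ℝ V y Complex.I‖ₑ :=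
    h1.trans ((lintegral_mono h2).trans h3.le)
  have h5 : ENNReal.ofReal (∫ y, ‖fderiv ℝ V y Complex.I‖) = ∫⁻ y, ‖fderiv ℝ V y Complex.I‖ₑ :=
    ofReal_integral_norm_eq_lintegral_enorm hint
  have h6 : ENNReal.ofReal ‖W z‖ ≤ ENNReal.ofReal (∫ y, ‖fderiv ℝ V y Complex.I‖) := by
    rw [ofReal_norm, h5]
    exact h4
  exact (ENNReal.ofReal_le_ofReal_iff (integral_nonneg fun _ => norm_nonneg _)).mp h6

end Literature.Geometry.Symplectic.JHolomorphicWeierstrassProof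

/-!
## Part `SullivanDualTameOrBrodyR4StubZalcman`:
### Stub `stub_zalcman` of line `Sketch` for crux `TameOrBrodyR4` (stmt-SmoothPoincare4-7826, route SullivanDual)

The elementary **Zalcman–Brody rescaling** of one entire `C^∞` flat-`J`-holomorphic map
`f : ℂ → ℝ⁴` with `f(D̄) ⊆ K` and `df(0) ≠ 0`.  Maximise the weighted derivative
`φ(ξ) = (1 - ‖ξ‖) ‖df(ξ)‖` over the closed unit disc (compact, and `φ` is continuous because `f`
is `C¹`), say at `ξ₀`, and put `M := φ(ξ₀) ≥ φ(0) = ‖df(0)‖ > 0`, `ρ := 1 / ‖df(ξ₀)‖ > 0` and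
`g(ζ) := f(ξ₀ + ρ ζ)`.  By the chain rule `dg(ζ) = ρ • df(ξ₀ + ρ ζ)`; hence `g` is `C^∞`,
flat-`J`-holomorphic (each `J_x` is linear) and `‖dg(0)‖ = 1`.  For `‖ζ‖ ≤ M / 2` the point
`ξ₀ + ρ ζ` has norm `≤ ‖ξ₀‖ + (1 - ‖ξ₀‖) / 2 ≤ 1`, so `g(ζ) ∈ K`, and maximality of `φ` at `ξ₀`
gives `‖df(ξ₀ + ρ ζ)‖ ≤ 2 ‖df(ξ₀)‖`, i.e. `‖dg(ζ)‖ ≤ 2`.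

References: L. Zalcman, *A heuristic principle in complex function theory*, Amer. Math. Monthly
82 (1975); R. Brody, *Compact manifolds and hyperbolicity*, Trans. AMS 235 (1978); for
`J`-curves B. Kruglikov, M. Overholt, Diff. Geom. Appl. 11 (1999), Thm 2.2.  Uses Mathlib only
(`IsCompact.exists_isMaxOn`, `isCompact_closedBall`, the chain rule `HasFDerivAt.comp`) and the
definition `Literature.Geometry.Symplectic.IsJHolomorphicFlat`.
-/

open scoped ContDiff Topology
open Filter Set Metric Literature.Geometry.Symplectic

namespace Literature.Geometry.Symplectic.JHolomorphicWeierstrassProof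

variable {d : ℕ}
namespace Zalcman

variable {E : Type*} [NormedAddCommGroup E] [NormedSpace ℝ E]

/-- Chain rule for a real affine reparametrisation of the source: for a differentiable
`f : ℂ → E`, the map `η ↦ f (ξ + ρ • η)` has derivative `ρ • df(ξ + ρ • ζ)` at `ζ`. [folklore] -/
theorem hasFDerivAt_comp_affine {f : ℂ → E} (hf : Differentiable ℝ f) (ξ : ℂ) (ρ : ℝ) (ζ : ℂ) :
    HasFDerivAt (fun η : ℂ => f (ξ + ρ • η)) (ρ • fderiv ℝ f (ξ + ρ • ζ)) ζ := by
  have haff : HasFDerivAt (fun η : ℂ => ξ + ρ • η) (ρ • ContinuousLinearMap.id ℝ ℂ) ζ :=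
    ((hasFDerivAt_id ζ).const_smul ρ).const_add ξ
  have hlin : (fderiv ℝ f (ξ + ρ • ζ)).comp (ρ • ContinuousLinearMap.id ℝ ℂ) =
      ρ • fderiv ℝ f (ξ + ρ • ζ) := by
    ext η
    simp
  have hcomp := (hf (ξ + ρ • ζ)).hasFDerivAt.comp ζ haff
  rw [hlin] at hcomp
  exact hcomp

/-- The derivative of the affine reparametrisation `η ↦ f (ξ + ρ • η)` is `ρ • df(ξ + ρ • ζ)`. [folklore] -/
theorem fderiv_comp_affine {f : ℂ → E} (hf : Differentiable ℝ f) (ξ : ℂ) (ρ : ℝ) (ζ : ℂ) :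
    fderiv ℝ (fun η : ℂ => f (ξ + ρ • η)) ζ = ρ • fderiv ℝ f (ξ + ρ • ζ) :=
  (hasFDerivAt_comp_affine hf ξ ρ ζ).fderiv

/-- Norm of the derivative of the affine reparametrisation, for a scale `ρ ≥ 0`. [folklore] -/
theorem norm_fderiv_comp_affine {f : ℂ → E} (hf : Differentiable ℝ f) (ξ : ℂ) {ρ : ℝ}
    (hρ : 0 ≤ ρ) (ζ : ℂ) :
    ‖fderiv ℝ (fun η : ℂ => f (ξ + ρ • η)) ζ‖ = ρ * ‖fderiv ℝ f (ξ + ρ • ζ)‖ := by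
  rw [fderiv_comp_affine hf, norm_smul, Real.norm_of_nonneg hρ]

/-- A real affine reparametrisation of the source preserves flat `J`-holomorphicity
(`J_x` is linear, so it commutes with the scalar `ρ`). [folklore] -/
theorem isJHolomorphicFlat_comp_affine {J : E → E →L[ℝ] E} {f : ℂ → E}
    (hf : Differentiable ℝ f) (hfJ : IsJHolomorphicFlat J f) (ξ : ℂ) (ρ : ℝ) :
    IsJHolomorphicFlat J (fun η : ℂ => f (ξ + ρ • η)) := by
  intro z ζ
  have h := hfJ (ξ + ρ • z) ζ
  simp only [fderiv_comp_affine hf, smul_apply]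
  rw [h, (J _).map_smul]

/-- A real affine reparametrisation of a `C^n` map is `C^n`. [folklore] -/
theorem contDiff_comp_affine {f : ℂ → E} {n : WithTop ℕ∞} (hf : ContDiff ℝ n f) (ξ : ℂ) (ρ : ℝ) :
    ContDiff ℝ n (fun η : ℂ => f (ξ + ρ • η)) :=
  hf.comp (contDiff_const.add (contDiff_const_smul ρ))

/-- `‖ξ + ρ • ζ‖ ≤ ‖ξ‖ + ρ ‖ζ‖` for `ρ ≥ 0`. [folklore] -/
theorem norm_affine_le (ξ ζ : ℂ) {ρ : ℝ} (hρ : 0 ≤ ρ) : ‖ξ + ρ • ζ‖ ≤ ‖ξ‖ + ρ * ‖ζ‖ := by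
  calc ‖ξ + ρ • ζ‖ ≤ ‖ξ‖ + ‖ρ • ζ‖ := norm_add_le _ _
    _ = ‖ξ‖ + ρ * ‖ζ‖ := by rw [norm_smul, Real.norm_of_nonneg hρ]

end Zalcman

/-- **Zalcman–Brody rescaling (stub `stub_zalcman`).** An entire `C^∞` flat-`J`-holomorphic
`f : ℂ → ℝ⁴` mapping the closed unit disc into `K`, with `df(0) ≠ 0`, has an affine
reparametrisation `g = f(ξ₀ + ρ ·)` which is `C^∞`, flat-`J`-holomorphic, normalised by
`‖dg(0)‖ = 1`, and satisfies `g(ζ) ∈ K` and `‖dg(ζ)‖ ≤ 2` on the disc `‖ζ‖ ≤ M / 2`, where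
`M = max_{‖ξ‖ ≤ 1} (1 - ‖ξ‖) ‖df(ξ)‖ ≥ ‖df(0)‖` (Zalcman 1975; Brody 1978). [folklore] -/
theorem stub_zalcman (J : (EuclideanSpace ℝ (Fin d)) → (EuclideanSpace ℝ (Fin d)) →L[ℝ] (EuclideanSpace ℝ (Fin d))) (K : Set (EuclideanSpace ℝ (Fin d))) (f : ℂ → (EuclideanSpace ℝ (Fin d)))
    (hf : ContDiff ℝ ∞ f) (hfJ : IsJHolomorphicFlat J f) (hfK : ∀ z : ℂ, ‖z‖ ≤ 1 → f z ∈ K)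
    (h0 : fderiv ℝ f 0 ≠ 0) :
    ∃ (g : ℂ → (EuclideanSpace ℝ (Fin d))) (M : ℝ), ‖fderiv ℝ f 0‖ ≤ M ∧ ContDiff ℝ ∞ g ∧ IsJHolomorphicFlat J g ∧
      (∀ ζ : ℂ, ‖ζ‖ ≤ M / 2 → g ζ ∈ K) ∧ ‖fderiv ℝ g 0‖ = 1 ∧
      (∀ ζ : ℂ, ‖ζ‖ ≤ M / 2 → ‖fderiv ℝ g ζ‖ ≤ 2) := by
  have hdiff : Differentiable ℝ f := hf.differentiable (by simp)
  -- the weighted derivative `φ ξ = (1 - ‖ξ‖) ‖df ξ‖` is continuous; maximise it on the closed disc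
  have hφc : Continuous fun ξ : ℂ => (1 - ‖ξ‖) * ‖fderiv ℝ f ξ‖ :=
    (continuous_const.sub continuous_norm).mul (hf.continuous_fderiv (by simp)).norm
  obtain ⟨ξ₀, hξ₀, hmax⟩ := (isCompact_closedBall (0 : ℂ) 1).exists_isMaxOn
    ⟨0, mem_closedBall_self zero_le_one⟩ hφc.continuousOn
  rw [isMaxOn_iff] at hmax
  rw [mem_closedBall_zero_iff] at hξ₀
  -- abbreviations: `a = 1 - ‖ξ₀‖`, `D = ‖df ξ₀‖`, `M = a * D`, `ρ = D⁻¹`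
  obtain ⟨a, ha⟩ : ∃ a : ℝ, a = 1 - ‖ξ₀‖ := ⟨_, rfl⟩
  obtain ⟨D, hD⟩ : ∃ D : ℝ, D = ‖fderiv ℝ f ξ₀‖ := ⟨_, rfl⟩
  have hmax' : ∀ w : ℂ, ‖w‖ ≤ 1 → (1 - ‖w‖) * ‖fderiv ℝ f w‖ ≤ a * D := fun w hw => by
    rw [ha, hD]
    exact hmax w (mem_closedBall_zero_iff.mpr hw)
  have hM0 : ‖fderiv ℝ f 0‖ ≤ a * D := by
    have := hmax' 0 (by simp)
    simpa using this
  have hMpos : 0 < a * D := (norm_pos_iff.mpr h0).trans_le hM0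
  have ha0 : 0 ≤ a := by rw [ha]; linarith
  have hD0 : 0 ≤ D := by rw [hD]; exact norm_nonneg _
  have hapos : 0 < a := lt_of_le_of_ne ha0 fun h => by
    rw [← h, zero_mul] at hMpos
    exact lt_irrefl 0 hMpos
  have hDpos : 0 < D := lt_of_le_of_ne hD0 fun h => by
    rw [← h, mul_zero] at hMpos
    exact lt_irrefl 0 hMpos
  obtain ⟨ρ, hρ⟩ : ∃ ρ : ℝ, ρ = D⁻¹ := ⟨_, rfl⟩
  have hρpos : 0 < ρ := by rw [hρ]; exact inv_pos.mpr hDpos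
  have hρD : ρ * D = 1 := by rw [hρ]; exact inv_mul_cancel₀ hDpos.ne'
  have hρM : ρ * (a * D / 2) = a / 2 := by
    rw [hρ]
    field_simp
  -- the disc `‖ζ‖ ≤ M / 2` is mapped into the disc `‖ξ‖ ≤ ‖ξ₀‖ + a / 2 ≤ 1`
  have hw : ∀ ζ : ℂ, ‖ζ‖ ≤ a * D / 2 → ‖ξ₀ + ρ • ζ‖ ≤ ‖ξ₀‖ + a / 2 := fun ζ hζ => by
    calc ‖ξ₀ + ρ • ζ‖ ≤ ‖ξ₀‖ + ρ * ‖ζ‖ := Zalcman.norm_affine_le ξ₀ ζ hρpos.le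
      _ ≤ ‖ξ₀‖ + ρ * (a * D / 2) := by gcongr
      _ = ‖ξ₀‖ + a / 2 := by rw [hρM]
  have hw1 : ∀ ζ : ℂ, ‖ζ‖ ≤ a * D / 2 → ‖ξ₀ + ρ • ζ‖ ≤ 1 := fun ζ hζ => by
    have := hw ζ hζ
    linarith
  refine ⟨fun η => f (ξ₀ + ρ • η), a * D, hM0, Zalcman.contDiff_comp_affine hf ξ₀ ρ,
    Zalcman.isJHolomorphicFlat_comp_affine hdiff hfJ ξ₀ ρ, fun ζ hζ => hfK _ (hw1 ζ hζ), ?_,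
    fun ζ hζ => ?_⟩
  · -- `‖dg(0)‖ = ρ ‖df(ξ₀)‖ = 1`
    rw [Zalcman.norm_fderiv_comp_affine hdiff ξ₀ hρpos.le, smul_zero, add_zero, ← hD, hρD]
  · -- `‖dg(ζ)‖ = ρ ‖df(ξ₀ + ρ ζ)‖ ≤ ρ · 2 D = 2` by maximality of `φ` at `ξ₀`
    rw [Zalcman.norm_fderiv_comp_affine hdiff ξ₀ hρpos.le]
    have h1 := hmax' _ (hw1 ζ hζ)
    have h2 : a / 2 ≤ 1 - ‖ξ₀ + ρ • ζ‖ := by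
      have := hw ζ hζ
      linarith
    have h3 : a / 2 * ‖fderiv ℝ f (ξ₀ + ρ • ζ)‖ ≤ a / 2 * (2 * D) :=
      calc a / 2 * ‖fderiv ℝ f (ξ₀ + ρ • ζ)‖
          ≤ (1 - ‖ξ₀ + ρ • ζ‖) * ‖fderiv ℝ f (ξ₀ + ρ • ζ)‖ :=
            mul_le_mul_of_nonneg_right h2 (norm_nonneg _)
        _ ≤ a * D := h1
        _ = a / 2 * (2 * D) := by ring
    have h4 : ‖fderiv ℝ f (ξ₀ + ρ • ζ)‖ ≤ 2 * D := le_of_mul_le_mul_left h3 (half_pos hapos)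
    calc ρ * ‖fderiv ℝ f (ξ₀ + ρ • ζ)‖ ≤ ρ * (2 * D) := mul_le_mul_of_nonneg_left h4 hρpos.le
      _ = 2 := by rw [mul_left_comm, hρD, mul_one]

end Literature.Geometry.Symplectic.JHolomorphicWeierstrassProof

/-!
## Part `SullivanDualTameOrBrodyR4StubSmoothLimit`:
### Stub `stub_smoothLimit` of line `Sketch` for crux `TameOrBrodyR4` (stmt-SmoothPoincare4-7826, route SullivanDual)

Smooth limits under locally uniform bounds on all derivatives: if `C^∞` maps `u n : ℂ → ℝ⁴`
converge locally uniformly to `v` and, for every order `k` and radius `r`, `‖D^k (u n)‖` is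
bounded on `closedBall 0 r` uniformly in `n`, then `v` is `C^∞` and `d(u n) → dv` locally
uniformly, along the whole sequence (no further subsequence). Proof:

* Landau–Kolmogorov interpolation (`SmoothLimit.norm_fderiv_le`): a `C²` map `f` with
  `‖D²f‖ ≤ M` and `‖f‖ ≤ δ` on `closedBall z ε` has `‖df(z)‖ ≤ 2δ/ε + Mε` (first-order Taylor
  estimate `Convex.norm_image_sub_le_of_norm_fderiv_le'` on the ball, tested on `z + ε • e`,
  `‖e‖ = 1`);
* applied to `u m - u n` on `closedBall 0 (r + 1)` it makes `d(u n)` uniformly Cauchy on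
  `closedBall 0 r` (`SmoothLimit.uniformCauchySeqOn_fderiv`); completeness gives a locally uniform
  limit of `d(u n)`, which is `dv` by `hasFDerivAt_of_tendstoLocallyUniformlyOn`
  (`SmoothLimit.differentiable_lim`);
* induction on the order `k`, over all complete real normed targets at once: the sequence of
  derivatives `d(u n) → dv` satisfies the same hypotheses (`‖D^j d(u n)‖ = ‖D^{j+1} (u n)‖`,
  `norm_iteratedFDeriv_fderiv`), so `contDiff_succ_iff_fderiv` gives `ContDiff ℝ k v` for every
  `k : ℕ` (`SmoothLimit.contDiff_lim`), i.e. `ContDiff ℝ ∞ v` (`contDiff_infty`).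

Folklore (real analysis; the interpolation inequality goes back to Landau 1913).
-/

open scoped ContDiff Topology
open Filter Set Metric

namespace Literature.Geometry.Symplectic.JHolomorphicWeierstrassProof

variable {d : ℕ}
namespace SmoothLimit

universe u

variable {E F : Type*} [NormedAddCommGroup E] [NormedSpace ℝ E]
  [NormedAddCommGroup F] [NormedSpace ℝ F]

/-- **Landau–Kolmogorov interpolation.** For a `C²` map `f` with `‖D²f‖ ≤ M` and `‖f‖ ≤ δ` on the
closed ball of radius `ε > 0` about `z`: `‖df(z)‖ ≤ 2δ/ε + Mε`. [folklore] -/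
theorem norm_fderiv_le {f : E → F} (hf : ContDiff ℝ 2 f) {z : E} {ε M δ : ℝ} (hε : 0 < ε)
    (hM : ∀ x ∈ closedBall z ε, ‖iteratedFDeriv ℝ 2 f x‖ ≤ M)
    (hδ : ∀ x ∈ closedBall z ε, ‖f x‖ ≤ δ) :
    ‖fderiv ℝ f z‖ ≤ 2 * δ / ε + M * ε := by
  have hd : Differentiable ℝ f := hf.differentiable (by simp)
  have hd' : Differentiable ℝ (fderiv ℝ f) :=
    (hf.fderiv_right (m := 1) (by norm_num)).differentiable (by simp)
  have hz : z ∈ closedBall z ε := mem_closedBall_self hε.le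
  have h0M : 0 ≤ M := (norm_nonneg _).trans (hM z hz)
  have h0δ : 0 ≤ δ := (norm_nonneg _).trans (hδ z hz)
  -- `‖D(Df)‖ = ‖D²f‖` (curried vs. uncurried second derivative)
  have hM' : ∀ x ∈ closedBall z ε, ‖fderiv ℝ (fderiv ℝ f) x‖ ≤ M := fun x hx => by
    rw [← norm_iteratedFDeriv_one (𝕜 := ℝ), norm_iteratedFDeriv_fderiv]; exact hM x hx
  -- on the ball the derivative is `M ε`-close to its value at the centre
  have h1 : ∀ x ∈ closedBall z ε, ‖fderiv ℝ f x - fderiv ℝ f z‖ ≤ M * ε := by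
    intro x hx
    calc ‖fderiv ℝ f x - fderiv ℝ f z‖ ≤ M * ‖x - z‖ :=
          (convex_closedBall z ε).norm_image_sub_le_of_norm_fderiv_le (fun y _ => hd' y) hM' hz hx
      _ ≤ M * ε := by gcongr; exact mem_closedBall_iff_norm.mp hx
  -- first-order Taylor estimate on the ball
  have h2 : ∀ x ∈ closedBall z ε, ‖f x - f z - fderiv ℝ f z (x - z)‖ ≤ M * ε * ε := by
    intro x hx
    calc ‖f x - f z - fderiv ℝ f z (x - z)‖ ≤ M * ε * ‖x - z‖ :=
          (convex_closedBall z ε).norm_image_sub_le_of_norm_fderiv_le' (fun y _ => hd y) h1 hz hx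
      _ ≤ M * ε * ε := by gcongr; exact mem_closedBall_iff_norm.mp hx
  refine ContinuousLinearMap.opNorm_le_of_unit_norm (by positivity) fun e he => ?_
  have hx : z + ε • e ∈ closedBall z ε := by
    rw [mem_closedBall_iff_norm, add_sub_cancel_left, norm_smul, he, mul_one,
      Real.norm_of_nonneg hε.le]
  have h3 := h2 _ hx
  rw [add_sub_cancel_left, map_smul] at h3
  have h4 : ε * ‖fderiv ℝ f z e‖ ≤ 2 * δ + M * ε * ε := by
    have h5 : ‖ε • fderiv ℝ f z e‖ ≤
        ‖f (z + ε • e)‖ + ‖f z‖ + ‖f (z + ε • e) - f z - ε • fderiv ℝ f z e‖ :=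
      calc ‖ε • fderiv ℝ f z e‖
            = ‖(f (z + ε • e) - f z) - (f (z + ε • e) - f z - ε • fderiv ℝ f z e)‖ := by
              congr 1; abel
        _ ≤ ‖f (z + ε • e) - f z‖ + ‖f (z + ε • e) - f z - ε • fderiv ℝ f z e‖ :=
              norm_sub_le _ _
        _ ≤ ‖f (z + ε • e)‖ + ‖f z‖ + ‖f (z + ε • e) - f z - ε • fderiv ℝ f z e‖ := by
              gcongr; exact norm_sub_le _ _
    rw [norm_smul, Real.norm_of_nonneg hε.le] at h5
    linarith [hδ _ hx, hδ z hz]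
  rw [div_add' _ _ _ hε.ne', le_div_iff₀ hε]
  linarith

/-- Derivatives of a locally uniformly convergent sequence of smooth maps on `ℂ` whose second
derivatives are bounded on every disc, uniformly along the sequence, are uniformly Cauchy on every
closed disc. [folklore] -/
theorem uniformCauchySeqOn_fderiv {u : ℕ → ℂ → F} {v : ℂ → F} (hu : ∀ n, ContDiff ℝ ∞ (u n))
    (hb : ∀ r : ℝ, ∃ C : ℝ, ∀ n, ∀ z ∈ closedBall (0 : ℂ) r, ‖iteratedFDeriv ℝ 2 (u n) z‖ ≤ C)
    (hlim : TendstoLocallyUniformly u v atTop) (r : ℝ) :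
    UniformCauchySeqOn (fun n => fderiv ℝ (u n)) atTop (closedBall (0 : ℂ) r) := by
  obtain ⟨C, hC⟩ := hb (r + 1)
  obtain ⟨M, h0M, hCM⟩ : ∃ M : ℝ, 0 ≤ M ∧ C ≤ M := ⟨max C 0, le_max_right _ _, le_max_left _ _⟩
  have hU : UniformCauchySeqOn u atTop (closedBall (0 : ℂ) (r + 1)) :=
    (tendstoLocallyUniformly_iff_forall_isCompact.mp hlim _
      (isCompact_closedBall _ _)).uniformCauchySeqOn
  rw [Metric.uniformCauchySeqOn_iff] at hU ⊢
  intro η hη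
  -- the interpolation radius `ε` and the sup-distance `η ε / 8`
  have hK : (0 : ℝ) < 4 * M + 1 := by positivity
  obtain ⟨ε, hε, hε1, hMε⟩ : ∃ ε : ℝ, 0 < ε ∧ ε ≤ 1 ∧ 2 * M * ε ≤ η / 2 := by
    refine ⟨min 1 (η / (4 * M + 1)), lt_min one_pos (div_pos hη hK), min_le_left _ _, ?_⟩
    have h12 : 2 * M / (4 * M + 1) ≤ 1 / 2 := by rw [div_le_iff₀ hK]; linarith
    calc 2 * M * min 1 (η / (4 * M + 1))
          ≤ 2 * M * (η / (4 * M + 1)) := by gcongr; exact min_le_right _ _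
      _ = 2 * M / (4 * M + 1) * η := by ring
      _ ≤ 1 / 2 * η := mul_le_mul_of_nonneg_right h12 hη.le
      _ = η / 2 := by ring
  obtain ⟨N, hN⟩ := hU (η * ε / 8) (by positivity)
  refine ⟨N, fun m hm n hn z hz => ?_⟩
  have hd : ∀ k x, DifferentiableAt ℝ (u k) x := fun k x => ((hu k).differentiable (by simp)) x
  have hsub : closedBall z ε ⊆ closedBall (0 : ℂ) (r + 1) :=
    closedBall_subset_closedBall' (by linarith [mem_closedBall.mp hz])
  have h2 : ContDiff ℝ 2 (u m - u n) := ((hu m).sub (hu n)).of_le (WithTop.coe_le_coe.mpr le_top)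
  have hMb : ∀ x ∈ closedBall z ε, ‖iteratedFDeriv ℝ 2 (u m - u n) x‖ ≤ M + M := by
    intro x hx
    rw [iteratedFDeriv_sub_apply ((hu m).of_le (WithTop.coe_le_coe.mpr le_top)).contDiffAt
      ((hu n).of_le (WithTop.coe_le_coe.mpr le_top)).contDiffAt]
    exact (norm_sub_le _ _).trans
      (add_le_add ((hC m x (hsub hx)).trans hCM) ((hC n x (hsub hx)).trans hCM))
  have hδb : ∀ x ∈ closedBall z ε, ‖(u m - u n) x‖ ≤ η * ε / 8 := fun x hx => by
    simpa only [Pi.sub_apply, ← dist_eq_norm] using (hN m hm n hn x (hsub hx)).le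
  change dist (fderiv ℝ (u m) z) (fderiv ℝ (u n) z) < η
  rw [dist_eq_norm, ← fderiv_sub (hd m z) (hd n z)]
  calc ‖fderiv ℝ (u m - u n) z‖ ≤ 2 * (η * ε / 8) / ε + (M + M) * ε :=
        norm_fderiv_le h2 hε hMb hδb
    _ = η / 4 + 2 * M * ε := by field_simp; ring
    _ < η := by linarith

/-- Under the hypotheses of `uniformCauchySeqOn_fderiv` (with a complete target), the limit `v` is
differentiable and `d(u n) → dv` locally uniformly. [folklore] -/
theorem differentiable_lim [CompleteSpace F] {u : ℕ → ℂ → F} {v : ℂ → F}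
    (hu : ∀ n, ContDiff ℝ ∞ (u n))
    (hb : ∀ r : ℝ, ∃ C : ℝ, ∀ n, ∀ z ∈ closedBall (0 : ℂ) r, ‖iteratedFDeriv ℝ 2 (u n) z‖ ≤ C)
    (hlim : TendstoLocallyUniformly u v atTop) :
    Differentiable ℝ v ∧
      TendstoLocallyUniformly (fun n => fderiv ℝ (u n)) (fderiv ℝ v) atTop := by
  have hU := uniformCauchySeqOn_fderiv hu hb hlim
  -- pointwise limits of the derivatives
  set G : ℂ → ℂ →L[ℝ] F := fun z => limUnder atTop fun n => fderiv ℝ (u n) z with hG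
  have hpt : ∀ z, Tendsto (fun n => fderiv ℝ (u n) z) atTop (𝓝 (G z)) := fun z =>
    ((hU ‖z‖).cauchySeq (mem_closedBall_zero_iff.mpr le_rfl)).tendsto_limUnder
  have hGl : TendstoLocallyUniformly (fun n => fderiv ℝ (u n)) G atTop := by
    refine tendstoLocallyUniformly_iff_forall_isCompact.mpr fun K hK => ?_
    obtain ⟨r, hr⟩ := hK.isBounded.subset_closedBall 0
    exact ((hU r).tendstoUniformlyOn_of_tendsto fun z _ => hpt z).mono hr
  have hderiv : ∀ z, HasFDerivAt v (G z) z := fun z =>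
    hasFDerivAt_of_tendstoLocallyUniformlyOn isOpen_univ hGl.tendstoLocallyUniformlyOn
      (fun n x _ => (((hu n).differentiable (by simp)) x).hasFDerivAt)
      (fun x _ => hlim.tendstoLocallyUniformlyOn.tendsto_at (mem_univ x)) (mem_univ z)
  have hfd : fderiv ℝ v = G := funext fun z => (hderiv z).fderiv
  exact ⟨fun z => (hderiv z).differentiableAt, hfd ▸ hGl⟩

/-- Smoothness of the limit of every finite order, by induction on the order simultaneously for
all complete targets (the induction step passes to the sequence of derivatives). [folklore] -/
theorem contDiff_lim (k : ℕ) :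
    ∀ {G : Type u} [NormedAddCommGroup G] [NormedSpace ℝ G] [CompleteSpace G]
      {u : ℕ → ℂ → G} {v : ℂ → G}, (∀ n, ContDiff ℝ ∞ (u n)) →
      (∀ (j : ℕ) (r : ℝ), ∃ C : ℝ, ∀ n, ∀ z ∈ closedBall (0 : ℂ) r,
        ‖iteratedFDeriv ℝ j (u n) z‖ ≤ C) →
      TendstoLocallyUniformly u v atTop → ContDiff ℝ k v := by
  induction k with
  | zero =>
    intro G _ _ _ u v hu hb hlim
    exact_mod_cast contDiff_zero.2
      (hlim.continuous (Eventually.of_forall fun n => (hu n).continuous).frequently)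
  | succ k ih =>
    intro G _ _ _ u v hu hb hlim
    obtain ⟨hdiff, hder⟩ := differentiable_lim hu (hb 2) hlim
    have hb' : ∀ (j : ℕ) (r : ℝ), ∃ C : ℝ, ∀ n, ∀ z ∈ closedBall (0 : ℂ) r,
        ‖iteratedFDeriv ℝ j (fderiv ℝ (u n)) z‖ ≤ C := fun j r => by
      obtain ⟨C, hC⟩ := hb (j + 1) r
      exact ⟨C, fun n z hz => by rw [norm_iteratedFDeriv_fderiv]; exact hC n z hz⟩
    have hk : ContDiff ℝ k (fderiv ℝ v) :=
      ih (fun n => (contDiff_infty_iff_fderiv.1 (hu n)).2) hb' hder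
    push_cast
    exact contDiff_succ_iff_fderiv.2 ⟨hdiff, fun h => absurd h (WithTop.natCast_ne_top k), hk⟩

end SmoothLimit

/-- **Smooth limits under locally uniform bounds on all derivatives.** If `C^∞` maps
`u n : ℂ → ℝ⁴` converge locally uniformly to `v` and, for every order `k` and radius `r`,
`‖D^k (u n)‖` is bounded on `closedBall 0 r` uniformly in `n`, then `v` is `C^∞` and
`d(u n) → dv` locally uniformly (along the whole sequence). [folklore] -/
theorem stub_smoothLimit (u : ℕ → ℂ → (EuclideanSpace ℝ (Fin d))) (v : ℂ → (EuclideanSpace ℝ (Fin d))) (hu : ∀ n, ContDiff ℝ ∞ (u n))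
    (hb : ∀ (k : ℕ) (r : ℝ), ∃ C : ℝ, ∀ n, ∀ z ∈ Metric.closedBall (0 : ℂ) r,
      ‖iteratedFDeriv ℝ k (u n) z‖ ≤ C)
    (hlim : TendstoLocallyUniformly u v atTop) :
    ContDiff ℝ ∞ v ∧ TendstoLocallyUniformly (fun n => fderiv ℝ (u n)) (fderiv ℝ v) atTop := by
  exact ⟨contDiff_infty.2 fun k => SmoothLimit.contDiff_lim k hu hb hlim,
    (SmoothLimit.differentiable_lim hu (hb 2) hlim).2⟩

end Literature.Geometry.Symplectic.JHolomorphicWeierstrassProof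

/-!
## Part `SullivanDualWitnessChargeHelperDerivBoundsLocal`:
### Derivative bounds on compact subsets from the local a priori estimate

Crux `WitnessCharge` (item stmt-SmoothPoincare4-7824, route SullivanDual), line `Sketch`, stub
`helper_derivBoundsLocal_of` (part of discharging the elliptic-regularity named fact
`JHolomorphicWeierstrassR4`).

**Statement.** Assume the LOCAL A PRIORI ESTIMATE on the unit disc: for every `C^∞` almost
complex structure `J` on `ℝ⁴` with `J² = -1`, every `R₀` and every order `k` there is a constant
`C(J, R₀, k)` such that every globally `C^∞` map `g : ℂ → ℝ⁴` that is flat `J`-holomorphic on the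
open disc `‖z‖ < 2` (`dg(z)(i ζ) = J(g z)(dg(z) ζ)`), bounded by `R₀` and with `‖dg‖ ≤ 2` on the
closed unit disc satisfies `‖Dᵏ g(0)‖ ≤ C`. Then for maps `u n` (`n ∈ ℕ`) that are `C^∞` and flat
`J`-holomorphic on an open `U ⊆ ℂ` only, with `C⁰` and `C¹` bounds uniform in `n` on every compact
subset of `U`, all derivatives are bounded uniformly in `n` on every compact subset of `U`.

**Proof (cover, translate + rescale, cut off, apply the estimate at every centre).** Given a
compact `K ⊆ U` choose `δ > 0` with `K' := cthickening δ K ⊆ U` (`K'` is compact) and bounds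
`‖u n‖ ≤ R`, `‖d(u n)‖ ≤ L` on `K'`; put `ρ := min (δ/3) (1/(L⁺+1))`, so `3ρ ≤ δ` and `ρ L ≤ 1`.
For `z ∈ K` the rescaled map `f(ζ) = u n (z + ρ ζ)` is smooth near the closed disc of radius `3`
(which is mapped into `closedBall z (3ρ) ⊆ K' ⊆ U`); multiplying by a bump `χ` equal to `1` on
the closed disc of radius `2` and supported in the disc of radius `3` gives a globally smooth `g`
agreeing with `f` near every point of the open disc of radius `2`. There `dg(ζ) = ρ • d(u n)(z+ρζ)`
(chain rule), so `g` is flat `J`-holomorphic on `‖ζ‖ < 2`, `‖g‖ ≤ R` and `‖dg‖ ≤ ρ L ≤ 1 ≤ 2` on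
the closed unit disc, whence `‖Dᵏ g(0)‖ ≤ C(J, R, k)`. Finally `Dᵏ g(0) = Dᵏ f(0)` is the
composition of `Dᵏ (u n)(z)` with the dilation by `ρ` in every slot, so
`ρᵏ ‖Dᵏ (u n)(z)‖ ≤ ‖Dᵏ g(0)‖ ≤ C`, i.e. `‖Dᵏ (u n)(z)‖ ≤ C / ρᵏ` uniformly in `n` and `z ∈ K`.

Uses only Mathlib (`ContDiffBump`, `IsCompact.exists_cthickening_subset_open`,
`Metric.closedBall_subset_cthickening`, `Filter.EventuallyEq.iteratedFDeriv`,
`ContinuousLinearEquiv.iteratedFDerivWithin_comp_right`, `iteratedFDeriv_comp_add_left`,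
`ContinuousMultilinearMap.opNorm_le_bound`).
-/

open scoped ContDiff Topology Nat
open Filter Set Metric

namespace Literature.Geometry.Symplectic.JHolomorphicWeierstrassProof

variable {d : ℕ}
/-- Undoing a dilation by `ρ > 0` in every slot of a continuous `k`-multilinear map costs a factor
`ρ⁻¹` per slot: `ρᵏ ‖T‖ ≤ ‖T ∘ (e, …, e)‖` when `e ζ = ρ • ζ`. [folklore] -/
theorem derivBoundsLocal_pow_mul_norm_le {k : ℕ}
    (T : ContinuousMultilinearMap ℝ (fun _ : Fin k => ℂ) (EuclideanSpace ℝ (Fin d)))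
    (e : ℂ →L[ℝ] ℂ) {ρ : ℝ} (hρ : 0 < ρ) (he : ∀ ζ : ℂ, e ζ = ρ • ζ) :
    ρ ^ k * ‖T‖ ≤ ‖T.compContinuousLinearMap fun _ => e‖ := by
  rw [← le_div_iff₀' (pow_pos hρ k)]
  refine ContinuousMultilinearMap.opNorm_le_bound (by positivity) fun m => ?_
  have hm : T m = (T.compContinuousLinearMap fun _ => e) fun i => ρ⁻¹ • m i := by
    rw [ContinuousMultilinearMap.compContinuousLinearMap_apply]
    congr 1
    funext i
    rw [he, smul_smul, mul_inv_cancel₀ hρ.ne', one_smul]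
  have hprod : ∏ i : Fin k, ‖ρ⁻¹ • m i‖ = ρ⁻¹ ^ k * ∏ i, ‖m i‖ := by
    simp only [norm_smul, Real.norm_eq_abs, abs_inv, abs_of_pos hρ, Finset.prod_mul_distrib,
      Finset.prod_const, Finset.card_univ, Fintype.card_fin]
  calc ‖T m‖ = ‖(T.compContinuousLinearMap fun _ => e) fun i => ρ⁻¹ • m i‖ := by rw [hm]
    _ ≤ ‖T.compContinuousLinearMap fun _ => e‖ * ∏ i, ‖ρ⁻¹ • m i‖ :=
        ContinuousMultilinearMap.le_opNorm _ _
    _ = ‖T.compContinuousLinearMap fun _ => e‖ / ρ ^ k * ∏ i, ‖m i‖ := by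
        rw [hprod, inv_pow, div_eq_mul_inv, mul_assoc]

/-- Rescaling by `ρ > 0` at `z` multiplies the norm of the `k`-th derivative by at least `ρᵏ`:
`ρᵏ ‖Dᵏ v(z)‖ ≤ ‖Dᵏ (v(z + ρ ·))(0)‖` (no smoothness assumption is needed, the dilation being a
continuous linear equivalence). [folklore] -/
theorem derivBoundsLocal_pow_mul_norm_iteratedFDeriv_le (v : ℂ → EuclideanSpace ℝ (Fin d))
    (z : ℂ) {ρ : ℝ} (hρ : 0 < ρ) (k : ℕ) :
    ρ ^ k * ‖iteratedFDeriv ℝ k v z‖ ≤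
      ‖iteratedFDeriv ℝ k (fun ζ : ℂ => v (z + ρ • ζ)) 0‖ := by
  obtain ⟨e, he⟩ : ∃ e : ℂ ≃L[ℝ] ℂ, ∀ ζ : ℂ, e ζ = ρ • ζ :=
    ⟨ContinuousLinearEquiv.equivOfInverse (ρ • ContinuousLinearMap.id ℝ ℂ)
      (ρ⁻¹ • ContinuousLinearMap.id ℝ ℂ) (fun ζ => by simp [hρ.ne'])
      (fun ζ => by simp [hρ.ne']), fun ζ => rfl⟩
  have h1 : (fun ζ : ℂ => v (z + ρ • ζ)) = (fun w : ℂ => v (z + w)) ∘ e := by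
    funext ζ
    simp [he]
  have h2 := e.iteratedFDerivWithin_comp_right (fun w : ℂ => v (z + w)) uniqueDiffOn_univ
    (x := 0) (mem_univ _) k
  simp only [preimage_univ, iteratedFDerivWithin_univ, map_zero] at h2
  rw [h1, h2, iteratedFDeriv_comp_add_left, add_zero]
  exact derivBoundsLocal_pow_mul_norm_le _ _ hρ he

/-- The affine pull-back `ζ ↦ v (z + ρ ζ)` of a map `C^∞` on an open `U` is `C^∞` at every `ζ`
with `z + ρ ζ ∈ U`. [folklore] -/
theorem derivBoundsLocal_contDiffAt_affine {U : Set ℂ} (hU : IsOpen U)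
    {v : ℂ → EuclideanSpace ℝ (Fin d)}
    (hv : ContDiffOn ℝ ∞ v U) (z : ℂ) (ρ : ℝ) {ζ : ℂ} (hζ : z + ρ • ζ ∈ U) :
    ContDiffAt ℝ ∞ (fun w : ℂ => v (z + ρ • w)) ζ := by
  have h1 : ContDiffAt ℝ ∞ (fun w : ℂ => z + ρ • w) ζ :=
    contDiffAt_const.add (contDiffAt_id.const_smul ρ)
  exact (hv.contDiffAt (hU.mem_nhds hζ)).comp ζ h1

/-- Chain rule for the affine pull-back: `d(v(z + ρ ·))(ζ) = d v(z + ρ ζ) ∘ (ρ • id)` whenever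
`v` is `C^∞` on an open `U ∋ z + ρ ζ`. [folklore] -/
theorem derivBoundsLocal_fderiv_affine {U : Set ℂ} (hU : IsOpen U)
    {v : ℂ → EuclideanSpace ℝ (Fin d)}
    (hv : ContDiffOn ℝ ∞ v U) (z : ℂ) (ρ : ℝ) {ζ : ℂ} (hζ : z + ρ • ζ ∈ U) :
    fderiv ℝ (fun w : ℂ => v (z + ρ • w)) ζ =
      (fderiv ℝ v (z + ρ • ζ)).comp (ρ • ContinuousLinearMap.id ℝ ℂ) := by
  have hd : DifferentiableAt ℝ v (z + ρ • ζ) :=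
    (hv.contDiffAt (hU.mem_nhds hζ)).differentiableAt (by simp)
  have haff : HasFDerivAt (fun w : ℂ => z + ρ • w) (ρ • ContinuousLinearMap.id ℝ ℂ) ζ :=
    ((ρ • ContinuousLinearMap.id ℝ ℂ).hasFDerivAt).const_add z
  exact (hd.hasFDerivAt.comp ζ haff).fderiv

/-- Cutting off by a bump function: if `f` is `C^∞` at every point of the closed ball
`closedBall 0 χ.rOut ⊇ tsupport χ`, then `χ • f` is globally `C^∞`. [folklore] -/
theorem derivBoundsLocal_contDiff_bump_smul (χ : ContDiffBump (0 : ℂ))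
    {f : ℂ → EuclideanSpace ℝ (Fin d)}
    (hf : ∀ ζ ∈ closedBall (0 : ℂ) χ.rOut, ContDiffAt ℝ ∞ f ζ) :
    ContDiff ℝ ∞ fun ζ => χ ζ • f ζ := by
  refine contDiff_iff_contDiffAt.2 fun ζ => ?_
  by_cases hζ : ζ ∈ tsupport χ
  · rw [χ.tsupport_eq] at hζ
    exact χ.contDiffAt.smul (hf ζ hζ)
  · rw [notMem_tsupport_iff_eventuallyEq] at hζ
    have h0 : (fun ζ => χ ζ • f ζ) =ᶠ[𝓝 ζ] fun _ => 0 := by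
      filter_upwards [hζ] with w hw
      simp [hw]
    exact contDiffAt_const.congr_of_eventuallyEq h0

/-- **Rescaling + cut-off at one centre.** For `v` `C^∞` and flat `J`-holomorphic on an open `U`,
a centre `z` and a scale `ρ > 0` with `closedBall z (3ρ) ⊆ U`, `‖v‖ ≤ R` and `‖dv‖ ≤ L` on that
ball and `ρ L ≤ 1`, there is a globally `C^∞` map `g` (namely `χ • v(z + ρ ·)`), flat
`J`-holomorphic on `‖ζ‖ < 2`, with `‖g‖ ≤ R` and `‖dg‖ ≤ 2` on the closed unit disc, and
`ρᵏ ‖Dᵏ v(z)‖ ≤ ‖Dᵏ g(0)‖` for every `k`. [folklore] -/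
theorem derivBoundsLocal_rescale
    (J : EuclideanSpace ℝ (Fin d) → EuclideanSpace ℝ (Fin d) →L[ℝ] EuclideanSpace ℝ (Fin d))
    {U : Set ℂ} (hU : IsOpen U)
    {v : ℂ → EuclideanSpace ℝ (Fin d)} (hv : ContDiffOn ℝ ∞ v U)
    (hvJ : ∀ p ∈ U, ∀ w : ℂ, fderiv ℝ v p (Complex.I * w) = J (v p) (fderiv ℝ v p w))
    (z : ℂ) {ρ R L : ℝ} (hρ : 0 < ρ) (hρL : ρ * L ≤ 1) (hsub : closedBall z (3 * ρ) ⊆ U)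
    (hR : ∀ p ∈ closedBall z (3 * ρ), ‖v p‖ ≤ R)
    (hL : ∀ p ∈ closedBall z (3 * ρ), ‖fderiv ℝ v p‖ ≤ L) :
    ∃ g : ℂ → EuclideanSpace ℝ (Fin d), ContDiff ℝ ∞ g ∧
      (∀ ζ : ℂ, ‖ζ‖ < 2 → ∀ w : ℂ, fderiv ℝ g ζ (Complex.I * w) = J (g ζ) (fderiv ℝ g ζ w)) ∧
      (∀ ζ : ℂ, ‖ζ‖ ≤ 1 → ‖g ζ‖ ≤ R) ∧ (∀ ζ : ℂ, ‖ζ‖ ≤ 1 → ‖fderiv ℝ g ζ‖ ≤ 2) ∧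
      ∀ k : ℕ, ρ ^ k * ‖iteratedFDeriv ℝ k v z‖ ≤ ‖iteratedFDeriv ℝ k g 0‖ := by
  obtain ⟨χ, hχIn, hχOut⟩ : ∃ χ : ContDiffBump (0 : ℂ), χ.rIn = 2 ∧ χ.rOut = 3 :=
    ⟨⟨2, 3, by norm_num, by norm_num⟩, rfl, rfl⟩
  -- the closed disc of radius `3` is mapped into `closedBall z (3ρ)`
  have hmem : ∀ ζ : ℂ, ‖ζ‖ ≤ 3 → z + ρ • ζ ∈ closedBall z (3 * ρ) := by
    intro ζ hζ
    rw [mem_closedBall, dist_self_add_left, norm_smul, Real.norm_eq_abs, abs_of_pos hρ]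
    nlinarith
  -- `χ = 1` near every point of the open disc of radius `2`
  have hgf : ∀ ζ : ℂ, ‖ζ‖ < 2 →
      (fun ζ => χ ζ • v (z + ρ • ζ)) =ᶠ[𝓝 ζ] fun ζ => v (z + ρ • ζ) := by
    intro ζ hζ
    have h1 : (χ : ℂ → ℝ) =ᶠ[𝓝 ζ] 1 :=
      χ.eventuallyEq_one_of_mem_ball (by rw [hχIn, mem_ball_zero_iff]; exact hζ)
    filter_upwards [h1] with w hw
    simp [hw]
  have hχ1 : ∀ ζ : ℂ, ‖ζ‖ ≤ 2 → χ ζ = 1 := fun ζ hζ =>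
    χ.one_of_mem_closedBall (by rw [hχIn, mem_closedBall_zero_iff]; exact hζ)
  refine ⟨fun ζ => χ ζ • v (z + ρ • ζ), ?_, ?_, ?_, ?_, ?_⟩
  · -- global smoothness
    refine derivBoundsLocal_contDiff_bump_smul χ fun ζ hζ => ?_
    rw [hχOut, mem_closedBall_zero_iff] at hζ
    exact derivBoundsLocal_contDiffAt_affine hU hv z ρ (hsub (hmem ζ hζ))
  · -- the equation on the open disc of radius `2`
    intro ζ hζ w
    have hp : z + ρ • ζ ∈ U := hsub (hmem ζ (by linarith))
    rw [(hgf ζ hζ).fderiv_eq, derivBoundsLocal_fderiv_affine hU hv z ρ hp]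
    simp only [hχ1 ζ hζ.le, one_smul, ContinuousLinearMap.comp_apply, smul_apply,
      ContinuousLinearMap.id_apply]
    rw [← mul_smul_comm]
    exact hvJ _ hp _
  · -- `C⁰` bound on the closed unit disc
    intro ζ hζ
    simp only [hχ1 ζ (by linarith), one_smul]
    exact hR _ (hmem ζ (by linarith))
  · -- gradient bound on the closed unit disc
    intro ζ hζ
    have hp : z + ρ • ζ ∈ closedBall z (3 * ρ) := hmem ζ (by linarith)
    rw [(hgf ζ (by linarith)).fderiv_eq, derivBoundsLocal_fderiv_affine hU hv z ρ (hsub hp)]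
    have hid : ‖ρ • ContinuousLinearMap.id ℝ ℂ‖ ≤ ρ := by
      rw [norm_smul, Real.norm_eq_abs, abs_of_pos hρ]
      exact mul_le_of_le_one_right hρ.le ContinuousLinearMap.norm_id_le
    have hL0 : 0 ≤ L := (norm_nonneg _).trans (hL _ hp)
    calc ‖(fderiv ℝ v (z + ρ • ζ)).comp (ρ • ContinuousLinearMap.id ℝ ℂ)‖
        ≤ ‖fderiv ℝ v (z + ρ • ζ)‖ * ‖ρ • ContinuousLinearMap.id ℝ ℂ‖ :=
          ContinuousLinearMap.opNorm_comp_le _ _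
      _ ≤ L * ρ := mul_le_mul (hL _ hp) hid (norm_nonneg _) hL0
      _ ≤ 2 := by rw [mul_comm]; linarith
  · -- comparison of the `k`-th derivatives at the centre
    intro k
    rw [((hgf 0 (by simp)).iteratedFDeriv ℝ k).eq_of_nhds]
    exact derivBoundsLocal_pow_mul_norm_iteratedFDeriv_le v z hρ k

/-- **Stub A4 (derivative bounds on compact subsets from the local a priori estimate).**
Flat `J`-holomorphic maps on an open `U` with `C⁰` and `C¹` bounds uniform in `n` on compact
subsets of `U` have all derivatives bounded uniformly in `n` on compact subsets of `U`
(cover, rescale to the unit disc, cut off, apply the local a priori estimate at every centre). [folklore] -/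
theorem helper_derivBoundsLocal_of :
    (∀ (J : EuclideanSpace ℝ (Fin d) → EuclideanSpace ℝ (Fin d) →L[ℝ] EuclideanSpace ℝ (Fin d)),
      ContDiff ℝ ∞ J → (∀ x v, J x (J x v) = -v) → ∀ (R₀ : ℝ) (k : ℕ),
    ∃ C : ℝ, ∀ g : ℂ → EuclideanSpace ℝ (Fin d), ContDiff ℝ ∞ g →
      (∀ z : ℂ, ‖z‖ < 2 → ∀ ζ : ℂ, fderiv ℝ g z (Complex.I * ζ) = J (g z) (fderiv ℝ g z ζ)) →
      (∀ z : ℂ, ‖z‖ ≤ 1 → ‖g z‖ ≤ R₀) → (∀ z : ℂ, ‖z‖ ≤ 1 → ‖fderiv ℝ g z‖ ≤ 2) →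
      ‖iteratedFDeriv ℝ k g 0‖ ≤ C) →
    ∀ (J : EuclideanSpace ℝ (Fin d) → EuclideanSpace ℝ (Fin d) →L[ℝ] EuclideanSpace ℝ (Fin d)),
      ContDiff ℝ ∞ J → (∀ x v, J x (J x v) = -v) →
    ∀ (U : Set ℂ), IsOpen U → ∀ (u : ℕ → ℂ → EuclideanSpace ℝ (Fin d)),
      (∀ n, ContDiffOn ℝ ∞ (u n) U) →
      (∀ n, ∀ z ∈ U, ∀ ζ : ℂ, fderiv ℝ (u n) z (Complex.I * ζ) = J (u n z) (fderiv ℝ (u n) z ζ)) →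
      (∀ K : Set ℂ, IsCompact K → K ⊆ U → ∃ R : ℝ, ∀ n, ∀ z ∈ K, ‖u n z‖ ≤ R) →
      (∀ K : Set ℂ, IsCompact K → K ⊆ U → ∃ L : ℝ, ∀ n, ∀ z ∈ K, ‖fderiv ℝ (u n) z‖ ≤ L) →
      ∀ (k : ℕ) (K : Set ℂ), IsCompact K → K ⊆ U →
        ∃ C : ℝ, ∀ n, ∀ z ∈ K, ‖iteratedFDeriv ℝ k (u n) z‖ ≤ C := by
  intro hA J hJs hJ2 U hU u hu huJ hC0 hC1 k K hK hKU
  -- (1) room: a compact closed thickening `K'` of `K` inside `U`, with `C⁰`/`C¹` bounds on it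
  obtain ⟨δ, hδ, hδU⟩ := hK.exists_cthickening_subset_open hU hKU
  obtain ⟨R, hR⟩ := hC0 (cthickening δ K) hK.cthickening hδU
  obtain ⟨L, hL⟩ := hC1 (cthickening δ K) hK.cthickening hδU
  obtain ⟨L', hLL', hL'0⟩ : ∃ L' : ℝ, L ≤ L' ∧ 0 ≤ L' :=
    ⟨max L 0, le_max_left _ _, le_max_right _ _⟩
  -- (2) the scale
  obtain ⟨ρ, hρ, h3ρ, hρL⟩ : ∃ ρ : ℝ, 0 < ρ ∧ 3 * ρ ≤ δ ∧ ρ * L' ≤ 1 := by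
    refine ⟨min (δ / 3) (1 / (L' + 1)), lt_min (by positivity) (by positivity), ?_, ?_⟩
    · linarith [min_le_left (δ / 3) (1 / (L' + 1))]
    · calc min (δ / 3) (1 / (L' + 1)) * L' ≤ 1 / (L' + 1) * L' :=
            mul_le_mul_of_nonneg_right (min_le_right _ _) hL'0
        _ ≤ 1 := by
            rw [div_mul_eq_mul_div, one_mul, div_le_one (by positivity)]
            linarith
  -- (3) the a priori constant, uniform in the centre and in `n`
  obtain ⟨C, hC⟩ := hA J hJs hJ2 R k
  refine ⟨C / ρ ^ k, fun n z hz => ?_⟩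
  have hsub : closedBall z (3 * ρ) ⊆ cthickening δ K :=
    (closedBall_subset_closedBall h3ρ).trans (closedBall_subset_cthickening hz δ)
  obtain ⟨g, hg, hgJ, hgR, hgd, hgk⟩ := derivBoundsLocal_rescale J hU (hu n) (huJ n) z hρ hρL
    (hsub.trans hδU) (fun p hp => hR n p (hsub hp)) (fun p hp => (hL n p (hsub hp)).trans hLL')
  rw [le_div_iff₀ (pow_pos hρ k), mul_comm]
  exact (hgk k).trans (hC g hg hgJ hgR hgd)

end Literature.Geometry.Symplectic.JHolomorphicWeierstrassProof

end
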